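import Summits.FinalStateConjecture.FinalStateConjecture.Theses.ZeroEnergyKerrOrBomb
import Summits.FinalStateConjecture.FinalStateConjecture.Theorems.ZeroEnergyRigidity.Negative.KerrParameterSign
import Literature.Geometry.Lorentzian.ZeroEnergyRayTrappedModFlow
import Literature.Geometry.Lorentzian.NonImprisonment
import Literature.Geometry.Lorentzian.GlobalHyperbolicityStrongCausality
import Literature.Geometry.Lorentzian.KerrStationaryBlackHole
import Literature.Geometry.Lorentzian.StationaryBlackHoleUniquenessProofs
import Literature.Geometry.Lorentzian.KillingFlowIsometry
import Literature.Geometry.Lorentzian.CausalityOpennessProofs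
import Literature.Geometry.Lorentzian.LorentzianMetricProofs
import Literature.Geometry.Manifold.OpenSubmanifoldMFDeriv
import Literature.Geometry.Lorentzian.CauchyProblemCauchy

/-!
# Disproof of `ZeroEnergyRigidity` (crux `stmt-FinalStateConjecture-10690`, route `ZeroEnergyKerrOrBomb`)

Standing adversary file (cdisprove seats `refuter-cdisprove-stmt-FinalStateConjecture-10690-0` (cycle 1),
`…-g2-0` (cycle 2), `…-g3-0` (cycle 3) and `…-g4-0` (cycle 4), 2026-08-16).  Prose lives in docstrings; every `theorem` without `sorry` is kernel-checked
(`lean check` rc 0); `sorry` appears ONLY in § (e) Near-misses, each with its obstruction.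

## Findings (index)

* **(F0) Elaborates.** `zeroEnergyRigidity_iff_telescope` (`Iff.rfl`): the served body is the ledger
  signature; hypotheses named `H1 … H5`, `NoImprisonedRay` (= h6), conclusion `KerrConclusion`.
* **(F1) NO KILL.** No `¬ ZeroEnergyRigidity` is claimed.  As typed the crux is a STRENGTHENING of
  smooth stationary vacuum black-hole uniqueness (h6 is void under h4, (F2)); a refutation needs a
  smooth, Ricci-flat, stationary, globally hyperbolic carrier with a connected non-degenerate future
  event horizon whose d.o.c. is not a sub-extremal Kerr exterior — none is known in print (it is the
  open uniqueness problem, believed TRUE; with the GLOBAL horizon Killing field of h3 (F3) it even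
  reduces to the two-Killing-field / non-rotating theorems modulo `I⁺`-regularity), and the junk
  surface of the formalisation is closed, see (F4).
* **(F2) h6 is load-free** (`zeroEnergyRigidity_iff_fullRigidityGH`): modulo the principle
  `NoImprisonedRayIsFree` (every zero-energy null geodesic ray on `[0,∞)` leaves every compact
  `K ⊆ doc` in a globally hyperbolic 𝓑 — non-imprisonment: tree facts
  `LorentzianMetric.bernalSanchez_isStronglyCausal_of_isGloballyHyperbolic` +
  `LorentzianMetric.IsStronglyCausal.exists_forall_notMem_of_isCompact` + endlessness of an affine
  null ray, Hawking–Ellis Prop. 6.4.7 / O'Neill Ch. 14 Lemma 13) the typed crux is EQUIVALENT to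
  `FullRigidityGH` (h6 deleted).  Six refuter notes (2026-08-15) say the same; this file makes the
  dependency a one-line hypothesis.  Consequence for provers: do not look for Γ₀ in the proof — as
  typed there is no Γ₀; consequence for the planner: restate (F5).
* **(F3) h3 hands out a global Killing field** (`exists_global_killing_of_H3`): `IsNonDegenerateHorizon`
  quantifies `∃ K, 𝓑.metric.IsKillingField K ∧ …` with `IsKillingField` pointwise on the WHOLE
  carrier (LeviCivita.lean:477).  With h2 this is the conclusion of Hawking's rigidity theorem as a
  hypothesis (card global-horizon-killing-field, TRIAGE-r1-1 D-h3).  Not a falsity lever (Kerr has it),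
  but it changes what the item says.
* **(F4) Junk surface closed** (docstring `junk_survey`): Minkowski / exterior-only / white-hole /
  super-extremal presentations have EMPTY future horizon (h2); `t*`-periodic quotients and charts
  reaching the Cauchy horizon or the regular disc `{r = 0}` are not globally hyperbolic (h4); extremal
  Kerr has κ = 0 (h3) AND no globally hyperbolic horizon-penetrating Kerr–Schild chart; Kerr–Newman
  is not Ricci-flat (h1); constant curves are not `IsNull` (v ≠ 0); `Kerr.Facts`, `HasLeviCivita` are
  consistent `Prop` classes; and NO proper `T`-invariant globally hyperbolic sub-carrier of a Kerr
  black-hole chart changes `doc` (max-`r` leak argument), so sub-presentations cannot refute the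
  "full Kerr exterior" conclusion.  In-tree inhabitant: `Kerr.stationaryAFBlackHoleOn` (all fields
  proved mod `Kerr.Facts`/`SliceFacts`/`isAsymptoticallyFlat_data`), for which the conclusion holds
  with Ψ = the chart inclusion once `doc = {r > r₊}` is proved.
* **(F5) Repairs.** `ZeroEnergyRigidityRay` (previous refuters' C′: `γ s ∉ stationaryOrbit T K`) and
  `ZeroEnergyRigidityModFlow` (C‴: the non-trapping clause VERBATIM as inlined by
  `BeltLiouville.SmoothHawkingRigidity` (stmt-10441) and
  `AnalyticityInvadesErgoregion.NonTrappingHawkingRigidity` (stmt-13896) =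
  `¬ 𝓑.HasZeroEnergyRayTrappedModFlow` unfolded).  Both elaborate; `typed → C′` is pure logic
  (`ray_of_zeroEnergyRigidity`), `typed → C‴` holds mod `NoImprisonedRayIsFree`.  RECOMMENDATION to
  the planner: restate with the mod-flow clause (maximal geodesics, open domain) — the `[0,∞)`-ray
  clause risks a second vacuity (in the Kerr chart `{r > r₀}` no zero-energy null geodesic meeting
  the d.o.c. is defined on a whole `[0,∞)`: future rays enter the hole and leave the chart at finite
  affine parameter, past rays leave through the past-horizon edge) — AND localise h3 to a collar
  (`U ⊇ horizon`, `K` Killing on `U`, `[T,K] = 0`), i.e. SHARE stmt-10441/13896's Hawking step and add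
  a Kerr-transfer glue (`ChruscielCostaHeusler2012_axisymmetricUniqueness` → chart form) instead of a
  fourth private copy of the AIK conjecture.
* **(F6) Mutations (for provers).** h5 (`T ≠ 0` on doc) — no counterexample known when dropped
  (possibly unnecessary; IK use it in Carleman arguments only).  h2 `IsConnected` → `Nonempty` — no
  smooth multi-horizon stationary vacuum configuration is known (static: Bunting–Masood-ul-Alam;
  double-Kerr: Neugebauer–Hennig non-existence), so connectedness is plausibly weakenable.  h4 is
  used twice: to void h6 and to exclude `t*`-periodic quotients (which satisfy h1–h3, h5, h6 and
  falsify the conclusion by π₁).  Do NOT strengthen the conclusion to `T`-equivariance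
  (`dΨ(∂_{t*}) = 𝓑.killing`) without normalising `g(T,T) → −1` at infinity: the structure admits
  `killing = c • T` for any `c > 0` (same orbits, `M_ext`, doc and horizon), for which equivariance
  fails while the typed conclusion holds.
* **(b) Tightness — LANDED p73548** (`Theorems/ZeroEnergyRigidity/Negative/KerrParameterSign.lean`,
  commit 5e9cea9d13f9; first submission p73316 bounced only by a gate restart): the reflection `y ↦ −y` is a bijective `IsIsometricImmersion` of the Kerr–Schild
  exteriors `Kerr(M, −a) → Kerr(M, a)` (`isIsometricImmersion_reflExt`), hence for EVERY `𝓑` the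
  conclusion holds with `(M, a)` iff with `(M, −a)` (`kerrExteriorPresentation_neg_iff`) and is
  equivalent to its normal form `0 ≤ a` (`exists_kerrExteriorPresentation_iff_nonneg`): the `∃ a` of
  the conclusion carries a redundant sign, an `∃!`-strengthening is false for rotating holes, a proof
  must fix the sign of `a` by an orientation convention.  § (b) below records the statements and the
  two corollaries at crux level (`KerrConclusion 𝓑 ↔ ∃ M a, IsSubextremal M a ∧ KerrExteriorPresentation
  𝓑 M a` is `Iff.rfl`; normal form `0 ≤ a`; `¬ ∃! (M,a)` for a rotating presentation since uniqueness
  would force `a = −a`) — to be kernel-linked by importing the module in cycle 2 (the check farm had not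
  built it when rev 3 was published).
* **(e) Near-misses** (sorried, docstrings carry witness + obstruction): `fullRigidity_false_without_H4`
  (Kerr/ℤ), `fullRigidity_false_without_H2` (Minkowski `ℝ⁴`), `fullRigidity_false_without_H1`
  (Kerr–Newman).  NOT claimed: without-H3 (see `junk_survey`), without-H5.
* **Targets**: none this cycle (`payload.targets = []`).
* **(F7) Predicted stub-kills for the lines in `Ideas/` (read before filing stubs).**  The telescope
  quantifies over EVERY presentation `𝓑`, including `T`-invariant globally hyperbolic sub-carriers of
  a Kerr black-hole chart that keep h1–h6 and the conclusion (junk (10)) but break auxiliary structure: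
  (i) "h1–h6 ⇒ `𝓑.IsIPlusRegular`" (compact horizon cross-sections; card global-horizon-killing-field's
  I⁺-regularity stub) is FALSE: for `U = I⁻(T·p₀)`, `p₀` an interior axis point, `horizon_U =
  ℝ × (open polar cap)` — connected, `K`-invariant, non-degenerate, with NON-COMPACT sections (the angular
  reach of timelike curves between `r₊` and `r(p₀) > r₋` is a proper cap); state I⁺-regularity as a
  HYPOTHESIS of the line (as `AnalyticityInvadesErgoregion` does) or derive only what the doc needs.
  (ii) "h3's `K` is complete on the carrier" is FALSE: `U = M ∖ cl J⁺(T·B̄)`, `B` a small closed ball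
  in the interior OFF the axis, is a `T`-invariant past set (GH), with the full horizon and full doc, on
  which `K = T + Ω_H Φ` is Killing but incomplete (`U` is not `Φ`-invariant); `K` IS complete on
  `doc ∪ horizon` — state completeness there (that is all Beig–Chruściel / the orbit analysis use).
  (iii) Any stub asserting a property of the black-hole INTERIOR of `𝓑` (beyond `horizon`) is exposed
  to such carvings; the conclusion only sees `doc`, so keep every stub on `doc ∪ horizon ∪ M_ext`.

## Cycle 2 additions (seat `refuter-cdisprove-stmt-FinalStateConjecture-10690-g2-0`, 2026-08-16)

LANDED under `Summits/FinalStateConjecture/FinalStateConjecture/Theorems/ZeroEnergyRigidity/Negative/`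
(importable by ideators / planners / provers; namespace `…Theorems.ZeroEnergyRigidity.Negative`):
`KerrParameterSign.lean` (gen 1, p73548), `KillingNonvanishingOfGH.lean` (p74906: (F8),
`killing_ne_zero_of_mem_doc_of_isGloballyHyperbolic`, `zeroEnergyRigidity_iff_withoutH5`),
`HorizonKillingScaling.lean` (p75584: (F9), `isKillingField_const_smul`,
`isNonDegenerateHorizon_witness_smul`, `isNonDegenerateHorizon_iff_exists_pos_kappa/neg_kappa`);
in review: `StationaryFieldRescaling.lean` (p75827: (F10), `StationaryRescale.rescale`,
`rescale_Mext/doc/horizon`, `rescale_killing_ne_zero_iff`, `rescale_zeroEnergy_iff`).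

* **(F8) h5 is REDUNDANT — kernel-checked** (`h5_of_h4`, `h5_of_isChronological`): `H4 𝓑 → H5 𝓑`
  for EVERY presentation, in three lines from tree theorems — Chruściel–Costa 2008 Cor. 3.8
  (`StationaryAFBlackHole.killing_ne_zero_of_mem_doc`, PROVED in
  `Literature.Geometry.Lorentzian.StationaryBlackHoleUniquenessProofs`: a zero of `T` in the d.o.c.
  is a compact flow-invariant set, and Lemma 3.7 turns it into a closed timelike curve through a
  finite `I⁺`-cover) and `IsGloballyHyperbolic → IsCausallyWellBehaved → IsChronological`.  Only the
  CHRONOLOGY clause of h4 is used (no compact diamonds).  Hence (pure logic,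
  `zeroEnergyRigidity_iff_withoutH5`) the typed crux is EQUIVALENT to itself with h5 deleted, and
  modulo non-imprisonment (F2) to `CoreRigidityGH := ∀ 𝓑, h1 → h2 → h3 → h4 → Kerr`
  (`zeroEnergyRigidity_iff_core`).  This settles gen-1's (F6) question "h5 possibly unnecessary":
  it is, provably.  For provers: `T ≠ 0` on `doc` comes for free and needs no Carleman input; for
  the planner: drop h5 at the next restate (it is decoration), or keep it knowing it costs nothing.
* **(b′) Tightness, kernel-linked** (the landed module `…Negative.KerrParameterSign` is now
  imported): `kerrConclusion_iff_exists_presentation` (`Iff.rfl`), `kerrConclusion_iff_nonneg`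
  (normal form `0 ≤ a`), and the refutation of the `∃!`-strengthening for rotating presentations,
  `not_existsUnique_params_of_rotating` (uniqueness of `(M, a)` would force `a = −a`).
* **(F9) h3 fixes neither the time-orientation nor the scale of its Killing field — kernel-checked**
  (`isKillingField_smul`, `h3Witness_smul`): if `(K, κ)` witnesses `IsNonDegenerateHorizon` then so
  does `(c • K, c κ)` for every `c ≠ 0` (Killing equation is linear; integral curves of `c • K` are
  reparametrised integral curves of `K`, `IsMIntegralCurve.comp_mul`; `∇_{cK}(cK) = c²∇_K K`).  So
  in the telescope `κ` carries exactly one bit (`κ ≠ 0`): "K future-directed", "κ > 0",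
  "K = T + Ω Φ with g(T,T) → −1" are NOT available from h3 and must be produced (orientation: free,
  take `c = −1`; the ORIENTED sign `κ > 0` for the future-directed choice: a genuine claim, see
  (F11)); any stub quantifying "the κ of h3" must be invariant under `κ ↦ cκ`.
* **(F11) Pre-triage of the ideator stubs in `SketchIdeator2.lean`** (docstring `sketchIdeator2_pretriage`):
  `HorizonKillingNormGradient` conjunct 1 (`g(K,K) = 0` on `𝓔⁺`) is stated for ALL `κ : ℝ`; for
  `κ ≠ 0` it is the tree lemma `IsKillingField.val_self_eq_zero_of_leviCivita_eq_smul` (re-exported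
  here as `horizonKilling_isNull`), for `κ = 0` the Killing identity degenerates to `0 = 0` and gives
  nothing — add `κ ≠ 0` (h3 has it); conjunct 2 in pointwise form is the tree lemma
  `IsKillingField.val_leviCivita_eq_neg_mul_of_leviCivita_eq_smul` plus metric compatibility.
  `TelescopeCollar` (`g(K,K) < 0` on `U ∩ doc`) hinges on the ORIENTED sign: for future-directed `K`,
  `Φ = g(K,K)` decreases into the d.o.c. side of `𝓔⁺` iff `κ > 0` (`dΦ(−N) = 2κ g(K,N) = −2κ` for the
  transverse future null `N`, `g(K,N) = −1`, and the d.o.c. lies on the PAST side of the achronal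
  boundary `∂I⁻(M_ext)`); with `κ < 0` the horizon branch is of past-horizon (white-hole) type relative
  to `K` — the Rácz–Wald bifurcation surface lies to the FUTURE along the generators, which are then
  future-incomplete K-orbits — and the d.o.c. side is the wedge where `K` is SPACELIKE.  Whether
  h1–h4 exclude `κ < 0` for the future-directed generator of `𝓔⁺` is NOT settled here (no in-tree or
  printed counterexample: in every Kerr/Kruskal presentation `κ > 0`; a would-be witness needs a GH
  carrier whose future event horizon has future-incomplete Killing generators with the bifurcation
  surface absent yet no GH-violating hole) — file it as an explicit stub "orientation lemma: the
  future-directed normalisation of h3's `K` has `κ > 0`" rather than burying it in the collar.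
  `KerrStuffingRigidity`: no cheap kill (a `T`-commuting compactly supported diffeomorphism pull-back
  is absorbed by the conclusion's `Ψ`; IK local hair lives behind the horizon, not in a compact part
  of the exterior); it is the card's genuine first lemma.
* **(F10) Normalisation of `T` is free — kernel-checked** (`rescale`, `rescale_Mext/doc/horizon`,
  `telescope_rescale_iff`): `𝓑` with `killing ↦ c • killing`, `c > 0`, is again a
  `StationaryAFBlackHole` with the same `M_ext` (orbits reparametrised), d.o.c. and horizon, and the
  whole crux instance (h1–h6 → conclusion) at `rescale 𝓑 hc` is LITERALLY EQUIVALENT to the instance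
  at `𝓑`.  So h1–h6 never see `g(T,T) → −1`; any stub identifying `T` with `∂_{t*}` of the Kerr chart
  (`dΨ e₀ = T`, `Ω_H`, `κ` of `T + Ω_H Φ` as NUMBERS) must first normalise `T` by the AF decay of the
  slice data — which the structure does carry (`isAsymptoticallyFlat`), but only for `h, k`, not `T`.
* **Still NO KILL (F1 stands).**  Cycle-2 attacks: (i) redundancy sweep of h5 (found redundant —
  information, not falsity); (ii) oriented-κ / white-hole-branch presentations (all Kruskal-type
  carvings are non-GH or have `𝓔⁺ = ∅` or `κ > 0`); (iii) Minkowski-with-boost, Rindler, C-metric,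
  Taub–NUT, Weyl multi-rod/strut and conical-deficit Kerr presentations (killed by the structure's
  `S²`-AF end with `T` timelike on it, by h4 through the removed axis/strut, or by h2);
  (iv) `IsSubextremal M a := |a| < M` admits no `M ≤ 0` junk in the conclusion; (v) the conclusion's
  `IsIsometricImmersion` is `ContMDiff ∞` + exact pull-back, no junk.  A refutation still needs a
  genuinely new smooth stationary vacuum black hole carrying a global horizon Killing field (F3) —
  i.e. a counterexample to Hawking-rigid uniqueness without `I⁺`-regularity; none is in print.

## Cycle 3 additions (seat `refuter-cdisprove-stmt-FinalStateConjecture-10690-g3-0`, 2026-08-16)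

* **(F12) Targets = the PICKED line `Lines/global-horizon-killing-field.lean`** (PICKED.md 02:50Z;
  5 stubs registered 02:29Z, reshaped by the lead prover-line-…-0 over tree vocabulary with S1
  outputting a complete commuting `K'`; `payload.targets = []`).  Kernel-checked: (T1) `IsNonRotating ⇒ g(T,T) = 0` on all
  of `𝓔⁺` (`val_killing_self_eq_zero_of_isNonRotating`) and the one-point test
  `not_isNonRotating_of_exists_val_ne_zero`; (T2) the dichotomy exhausts h3
  (`isNonRotating_or_hasIndependentHorizonKilling`); (T3) `DocIsometry` is reflexive
  (`docIsometry_refl`) — stub 1 is trivially true at `I⁺`-regular presentations and is otherwise the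
  crux itself; **(T4) stub S5 and (T5) stub S4 PROVED AS TYPED** (`docIsometryTransfer_gen` — the
  reshaped S5 with arbitrary `hF' hP' hres'` —, `docIsometryTransfer`, `kerrChartTransfer`; sorry-free;
  evidence file `StubProofs.lean` carries them with the skeleton's exact signatures); (T6) hence the
  line = S1–S3 exactly (`zeroEnergyRigidity_of_stubs123 : Stub1 → Stub2 → Stub3 → ZeroEnergyRigidity`
  over the RESHAPED S1–S3, kernel-checked).  Verdicts (`targets_pretriage`): NO STUB BROKEN; S4–S5
  closed here; S2 classical; S3's proof-plan trap (vendored CCH12 needs a carrier-complete axial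
  `Y`, false on carved presentations, F7(ii)) is RESOLVED by the reshape (completeness + commutation
  of `K'` produced by S1, assumed by S3); S1 carries all the open content (= the crux).
* **(F13)** junk (13) made robust: `Kerr/antipodal` admits no AF slice AT ALL (odd-function argument
  on the asymptotic graph), so it is excluded by the structure, not by h1–h6 (`cycle3_survey`).
* **(F14)** `κ < 0` / orientation hunt: Kruskal (true conclusion), Kerr from the `r → −∞` end
  (totally vicious, ¬h4), ℝP³ geon (not stationary), shifted antipodal quotient (CTC) — all dead; the
  orientation lemma stays open and is equivalent (for `K` complete on `𝓔⁺`) to future affine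
  completeness of the horizon generators.
* **(F15)** exact-solution sweep (Weyl/TS/Manko–Novikov/double-Kerr/C-metric/NUT/…): no inhabitant
  of h1–h4 other than Kerr presentations; (F16) `M_ext` is not "near infinity" (typing remark).
* **(b″) Tightness II** (`KerrTimeTranslation.lean`, proposed p78657 to `Negative/`): the isometry `Ψ` of the
  conclusion is NEVER unique (`¬ ∃! Ψ` for every `𝓑, M, a`, by the Killing time translation of the
  Kerr–Schild chart), see `tightness_pointer2`.  **F1 STANDS: no kill in cycle 3.**

## Cycle 4 additions (seat `refuter-cdisprove-stmt-FinalStateConjecture-10690-g4-0`, 2026-08-16)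

* **(F17) h2 IS LOAD-BEARING — the near-miss `fullRigidity_false_without_H2` is now PROVED
  (sorry-free, axioms {propext, Classical.choice, Quot.sound}, NO named fact and NO instance
  hypothesis: `Kerr.Facts` and the Levi-Civita class are discharged by tree theorems).**  LANDED
  under `Theorems/ZeroEnergyRigidity/Negative/` (namespace `…Theorems.ZeroEnergyRigidity.Negative`):
  `MinkowskiPresentation.lean` (p80915, commit a2a9cdfa3a83) and `MinkowskiNoHorizon.lean` (p82698,
  commit 6f07fceca40e) — import the latter to use any of it.  Contents:
  `MinkowskiPresentation.lean` (`minkowskiBH : StationaryAFBlackHole` = Minkowski `(ℝ⁴, η, ∂ₜ)`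
  with slice `{t = 0}`, trivial data `(δ, 0)`, end `{‖y‖ > 1}`, Killing field `∂ₜ` — every structure
  field a tree theorem; `I^±(M_ext) = ℝ⁴` by straight timelike segments, `doc_minkowskiBH : doc = univ`,
  `horizon_minkowskiBH : 𝓔⁺ = ∅`) and `MinkowskiNoHorizon.lean` (`zeroEnergyRigidity_false_without_H2 :
  ¬ (crux with `IsConnected 𝓑.horizon` deleted, rest verbatim)`).  At `minkowskiBH`: h1 =
  `Minkowski.isRicciFlat_holds`; h3 holds VACUOUSLY (empty horizon: `K = ∂ₜ`, `κ = 1` — the *Warning*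
  in `Stationary.lean` made concrete); h4 = `Minkowski.isGloballyHyperbolic`
  (`MinkowskiGlobalHyperbolicity.lean`); h5 `∂ₜ ≠ 0`; h6 VACUOUSLY (a null `v` with `η(∂ₜ,v) = 0` is
  `0`); and the CONCLUSION FAILS (`not_kerrConclusion_minkowskiBH`): a bijective isometric immersion
  `Ψ : (Kerr.exterior M a, g_{M,a}) → (ℝ⁴, η)`, `|a| < M`, has invertible differential (pull-back
  identity + non-degeneracy of `g_{M,a}`), hence is a diffeomorphism (tree IFT
  `Literature.Geometry.Manifold.isLocalDiffeomorphAt_of_mfderiv` + Mathlib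
  `IsLocalDiffeomorph.diffeomorphOfBijective`), and `{r > r₊} ↪ {r > 0}` composed with `Ψ⁻¹` is a
  smooth isometric open embedding of Minkowski spacetime onto a PROPER open subset (a point of
  spatial norm `r₊` has `0 < r ≤ r₊`) of the connected chart `({r > 0}, g_{M,a})` — a `C^∞ ⊇ C⁰`
  extension, contradicting SBIERSKI's theorem, which is PROVED in the tree
  (`minkowski_isC0Inextendible_holds`, `ExtensionProofs.lean`).  Consequences: (i) the load-bearing
  map of the typed crux is now h1 (conjectural witness Kerr–Newman, near-miss), h2 (PROVED necessary),
  h3 (unoriented `κ`, F9; necessity open — no degenerate GH vacuum presentation in tree), h4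
  (conjectural witness Kerr/ℤ, near-miss), h5 REDUNDANT (F8), h6 VOID (F2); (ii) any restate that
  weakens h2 to admit an empty horizon must weaken the conclusion to "Kerr OR Minkowski" (the typed
  `IsSubextremal M a` forces `M > 0`); (iii) all registered stubs of the three lines carry
  `IsConnected 𝓑.horizon` (S1–S3 of the picked line; `IsKillingTimelikeCollar` in the frontier line;
  the Pohozaev line's G1/G2 are TRUE at `minkowskiBH` — escape pair `b = −∂_{x¹}, f = x¹, α = 1`; flat
  Killing fields extend affinely) — so the Minkowski witness breaks NO current stub (checked on paper,
  `cycle4_survey`).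
* **(F18) Literature refresh (degraded: local FTS db unavailable, OpenAlex/arXiv HTTP 429):** s2/crossref
  2022–2026 on smooth (non-analytic) stationary vacuum uniqueness: arXiv:2509.05789 (Fang 2025,
  uniqueness of Kerr–de Sitter, AIK-type), Lai–Li–Yu JDG 2023 (rigidity of stationary charged holes,
  small perturbations of non-extremal Kerr–Newman — perturbative AIK class), Lucietti–Tomlinson ATMP
  2022 (moduli of stationary vacuum holes from integrability — axisymmetric), Harvie–Wang CMP 2026
  (static ALH) — NO counterexample to `CoreRigidityGH`, no non-perturbative smooth rigidity theorem.
  **F1 STANDS: no kill in cycle 4.**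
-/

noncomputable section

set_option linter.dupNamespace false

namespace Summit.FinalStateConjecture.FinalStateConjecture.Cruxes.ZeroEnergyRigidity.Disproof

open Set Literature.Geometry.Lorentzian
open scoped Manifold ContDiff Topology
open Summit.FinalStateConjecture.FinalStateConjecture.Theses.ZeroEnergyKerrOrBomb (ZeroEnergyRigidity)

/-! ## (F0) The telescope, named -/

section Telescope

variable (𝓑 : StationaryAFBlackHole.{0}) [𝓑.metric.HasLeviCivita]

/-- h1: vacuum. -/
def H1 : Prop := 𝓑.metric.toPseudoRiemannianMetric.IsRicciFlat

/-- h2: connected (hence non-empty) future event horizon `𝓔⁺ = ∂I⁻(M_ext) ∩ I⁺(M_ext)`. -/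
def H2 : Prop := IsConnected 𝓑.horizon

/-- h3: non-degenerate horizon — NB: `∃ K` with `𝓑.metric.IsKillingField K` GLOBAL (F3). -/
def H3 : Prop := 𝓑.toSpacetime.IsNonDegenerateHorizon 𝓑.Mext

/-- h4: the CARRIER is globally hyperbolic (causal + compact diamonds). -/
def H4 : Prop := 𝓑.metric.IsGloballyHyperbolic 𝓑.timeOrientation

/-- h5: the stationary field has no zero in the d.o.c. -/
def H5 : Prop := ∀ p ∈ 𝓑.doc, 𝓑.killing p ≠ 0

/-- h6 as typed: every zero-energy null geodesic RAY on `[0,∞)` leaves every compact `K ⊆ doc`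
(compact IN SPACETIME — this is what makes it a theorem under h4, (F2)). -/
def NoImprisonedRay : Prop :=
  ∀ γ : ℝ → 𝓑.carrier, IsGeodesicOn 𝓑.metric.leviCivita γ (Set.Ici 0) →
    (∀ s : ℝ, 0 ≤ s → 𝓑.metric.IsNull (velocity (𝓡 4) γ s) ∧
      𝓑.metric.val (γ s) (𝓑.killing (γ s)) (velocity (𝓡 4) γ s) = 0) →
    ∀ K : Set 𝓑.carrier, IsCompact K → K ⊆ 𝓑.doc → ∃ s : ℝ, 0 ≤ s ∧ γ s ∉ K

/-- The conclusion: the d.o.c. is a sub-extremal Kerr exterior, fact-free chart form. -/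
def KerrConclusion [Kerr.Facts] : Prop :=
  ∃ (M a : ℝ), Kerr.IsSubextremal M a ∧ ∃ Ψ : Kerr.exterior M a → 𝓑.carrier,
    Function.Injective Ψ ∧ Set.range Ψ = 𝓑.doc ∧
      PseudoRiemannianMetric.IsIsometricImmersion
        (Kerr.smoothMetric M a (Kerr.rPlus M a)).toPseudoRiemannianMetric
        𝓑.metric.toPseudoRiemannianMetric Ψ

end Telescope

/-- **(F0)** The crux, read back: `Iff.rfl` with the served body. -/
theorem zeroEnergyRigidity_iff_telescope :
    ZeroEnergyRigidity ↔
      ∀ (𝓑 : StationaryAFBlackHole.{0}) [𝓑.metric.HasLeviCivita] [Kerr.Facts],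
        H1 𝓑 → H2 𝓑 → H3 𝓑 → H4 𝓑 → H5 𝓑 → NoImprisonedRay 𝓑 → KerrConclusion 𝓑 :=
  Iff.rfl

/-! ## (F2) Load-bearing analysis: h6 carries nothing -/

/-- The crux with h6 DELETED: unconditional smooth stationary vacuum black-hole uniqueness in this
telescope (Chruściel–Costa 2008 Conj.-1.2 type, with h3's global horizon Killing field thrown in). -/
def FullRigidityGH : Prop :=
  ∀ (𝓑 : StationaryAFBlackHole.{0}) [𝓑.metric.HasLeviCivita] [Kerr.Facts],
    H1 𝓑 → H2 𝓑 → H3 𝓑 → H4 𝓑 → H5 𝓑 → KerrConclusion 𝓑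

/-- **"h6 is free"**: in a globally hyperbolic `𝓑` no zero-energy null geodesic ray on `[0,∞)` is
imprisoned in a compact subset of spacetime.  TRUE by non-imprisonment: `H4` ⇒ strongly causal
(`LorentzianMetric.bernalSanchez_isStronglyCausal_of_isGloballyHyperbolic`, Bernal–Sánchez 2007
Thm 3.2, the carrier being Hausdorff/second countable/connected/boundaryless by the `Spacetime`
fields) ⇒ an endless causal curve leaves every compact set
(`LorentzianMetric.IsStronglyCausal.exists_forall_notMem_of_isCompact`, O'Neill 1983 Ch. 14
Lemma 13 = Hawking–Ellis Prop. 6.4.7), applied to the ray (future- or past-directed throughout, by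
continuity of `γ̇ ≠ 0`; endless because an affinely parametrised non-constant geodesic on `[0,∞)` has
no endpoint, O'Neill Ch. 14 / chart estimate `|x''| ≤ C|x'|²`).  Zero energy and `K ⊆ doc` play no
role.  Kept as a named hypothesis here (the two tree facts are themselves `def … : Prop`). -/
def NoImprisonedRayIsFree : Prop :=
  ∀ (𝓑 : StationaryAFBlackHole.{0}) [𝓑.metric.HasLeviCivita], H4 𝓑 → NoImprisonedRay 𝓑

/-- Deleting a hypothesis only strengthens: `FullRigidityGH → ZeroEnergyRigidity` (pure logic). -/
theorem zeroEnergyRigidity_of_fullRigidityGH (h : FullRigidityGH) : ZeroEnergyRigidity :=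
  fun 𝓑 _ _ h1 h2 h3 h4 h5 _ ↦ h 𝓑 h1 h2 h3 h4 h5

/-- **(F2)** Modulo non-imprisonment the typed crux IS full smooth rigidity: the "no trapped
zero-energy ray" hypothesis is discharged by `H4` itself, so any proof of the item as typed proves
unconditional uniqueness and never meets `Γ₀`. -/
theorem zeroEnergyRigidity_iff_fullRigidityGH (hfree : NoImprisonedRayIsFree) :
    ZeroEnergyRigidity ↔ FullRigidityGH :=
  ⟨fun h 𝓑 _ _ h1 h2 h3 h4 h5 ↦ h 𝓑 h1 h2 h3 h4 h5 (hfree 𝓑 h4),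
    zeroEnergyRigidity_of_fullRigidityGH⟩

/-! ## (F3) h3 hands out a GLOBAL Killing field -/

/-- **(F3)** From h3 alone: a vector field `K`, Killing on the WHOLE carrier, non-vanishing on and
tangent to the horizon, with `∇_K K = κ K`, `κ ≠ 0`, there (definitional unfolding of
`LorentzianMetric.IsNonDegenerateHorizon`).  With h2 (horizon ≠ ∅) `K ≠ 0`; `K ∈ ℝT` is the
non-rotating case, `K ∉ ℝT` a second Killing field — Hawking's rigidity conclusion as a hypothesis. -/
theorem exists_global_killing_of_H3 (𝓑 : StationaryAFBlackHole.{0}) [𝓑.metric.HasLeviCivita]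
    (h3 : H3 𝓑) :
    ∃ K : Π x : 𝓑.carrier, TangentSpace (𝓡 4) x, 𝓑.metric.IsKillingField K ∧
      (∀ p ∈ 𝓑.horizon, K p ≠ 0) ∧
      (∀ γ : ℝ → 𝓑.carrier, IsMIntegralCurve γ K → γ 0 ∈ 𝓑.horizon → ∀ t, γ t ∈ 𝓑.horizon) ∧
      ∃ κ : ℝ, κ ≠ 0 ∧ ∀ p ∈ 𝓑.horizon, 𝓑.metric.leviCivita K p (K p) = κ • K p :=
  h3

/-- The horizon Killing field of h3 is NULL on the horizon: `κ g(K,K) = g(∇_K K, K) = 0` by the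
Killing equation at `(K, K)`.  (Re-derivation of the triage's W.lean example; recorded so that
provers can cite it from this file.) -/
theorem horizonKilling_isNull (𝓑 : StationaryAFBlackHole.{0}) [𝓑.metric.HasLeviCivita]
    {K : Π x : 𝓑.carrier, TangentSpace (𝓡 4) x} (hK : 𝓑.metric.IsKillingField K)
    {κ : ℝ} (hκ : κ ≠ 0) {p : 𝓑.carrier}
    (hp : 𝓑.metric.leviCivita K p (K p) = κ • K p) :
    𝓑.metric.val p (K p) (K p) = 0 := by
  have h := hK.2 p (K p) (K p)
  rw [hp, map_smul, FunLike.coe_smul, Pi.smul_apply, (𝓑.metric.val p (K p)).map_smul] at h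
  simp only [smul_eq_mul] at h
  have : 2 * κ * 𝓑.metric.val p (K p) (K p) = 0 := by linarith
  rcases mul_eq_zero.mp this with h' | h'
  · exact absurd (by linarith : κ = 0) hκ
  · exact h'

/-! ## (F5) Repaired statements (elaborate; for the planner) -/

section Repairs

variable (𝓑 : StationaryAFBlackHole.{0}) [𝓑.metric.HasLeviCivita]

/-- C′ (previous refuters, Repair.lean / Verdict.lean): the `[0,∞)`-ray escapes the `T`-ORBIT of
every compact `K ⊆ doc` (compact modulo the stationary flow). -/
def NoTrappedRayModOrbit : Prop :=
  ∀ γ : ℝ → 𝓑.carrier, IsGeodesicOn 𝓑.metric.leviCivita γ (Set.Ici 0) →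
    (∀ s : ℝ, 0 ≤ s → 𝓑.metric.IsNull (velocity (𝓡 4) γ s) ∧
      𝓑.metric.val (γ s) (𝓑.killing (γ s)) (velocity (𝓡 4) γ s) = 0) →
    ∀ K : Set 𝓑.carrier, IsCompact K → K ⊆ 𝓑.doc →
      ∃ s : ℝ, 0 ≤ s ∧ γ s ∉ 𝓑.toSpacetime.stationaryOrbit 𝓑.killing K

/-- C‴ (recommended): no MAXIMAL zero-energy null geodesic is trapped modulo the flow — verbatim
the clause inlined in `BeltLiouville.SmoothHawkingRigidity` / `…NonTrappingHawkingRigidity`, i.e.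
`¬ 𝓑.HasZeroEnergyRayTrappedModFlow` unfolded (`not_hasZeroEnergyRayTrappedModFlow_iff`). -/
def NoTrappedGeodesicModFlow : Prop :=
  ∀ S : Set 𝓑.carrier, IsCompact S → S ⊆ 𝓑.doc → ∀ (γ : ℝ → 𝓑.carrier) (s : Set ℝ),
    IsMaximalGeodesicOn 𝓑.metric.toPseudoRiemannianMetric.leviCivita γ s → s.Nonempty →
      (∀ t ∈ s, 𝓑.metric.val (γ t) (velocity (𝓡 4) γ t) (velocity (𝓡 4) γ t) = 0 ∧
        velocity (𝓡 4) γ t ≠ 0 ∧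
          𝓑.metric.val (γ t) (velocity (𝓡 4) γ t) (𝓑.killing (γ t)) = 0) →
      ∃ t ∈ s, γ t ∉ stationaryOrbit 𝓑.killing S

/-- C‴'s hypothesis is literally `¬ HasZeroEnergyRayTrappedModFlow` (share-compatibility check). -/
theorem noTrappedGeodesicModFlow_iff :
    NoTrappedGeodesicModFlow 𝓑 ↔ ¬ 𝓑.HasZeroEnergyRayTrappedModFlow :=
  (𝓑.not_hasZeroEnergyRayTrappedModFlow_iff).symm

end Repairs

/-- C′ as a full statement (all other hypotheses and the conclusion verbatim). -/
def ZeroEnergyRigidityRay : Prop :=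
  ∀ (𝓑 : StationaryAFBlackHole.{0}) [𝓑.metric.HasLeviCivita] [Kerr.Facts],
    H1 𝓑 → H2 𝓑 → H3 𝓑 → H4 𝓑 → H5 𝓑 → NoTrappedRayModOrbit 𝓑 → KerrConclusion 𝓑

/-- C‴ as a full statement (recommended restate, modulo the separate h3-localisation of (F3)). -/
def ZeroEnergyRigidityModFlow : Prop :=
  ∀ (𝓑 : StationaryAFBlackHole.{0}) [𝓑.metric.HasLeviCivita] [Kerr.Facts],
    H1 𝓑 → H2 𝓑 → H3 𝓑 → H4 𝓑 → H5 𝓑 → NoTrappedGeodesicModFlow 𝓑 → KerrConclusion 𝓑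

/-- `K ⊆ ⋃ₜ φₜ(K)` for the complete stationary field, so escaping the orbit is stronger than
escaping `K`: C′'s hypothesis implies the typed h6. -/
theorem noImprisonedRay_of_noTrappedRayModOrbit (𝓑 : StationaryAFBlackHole.{0})
    [𝓑.metric.HasLeviCivita] (h : NoTrappedRayModOrbit 𝓑) : NoImprisonedRay 𝓑 := by
  intro γ hγ hz K hK hKd
  obtain ⟨s, hs, hns⟩ := h γ hγ hz K hK hKd
  exact ⟨s, hs, fun hmem ↦ hns
    (subset_stationaryOrbit 𝓑.isStationary.isCompleteVectorField K hmem)⟩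

/-- **typed → C′** (pure logic + completeness of `T`): the repair's witness misses nothing the
typed item proves; the converse is the content of the AIK conjecture. -/
theorem ray_of_zeroEnergyRigidity (h : ZeroEnergyRigidity) : ZeroEnergyRigidityRay :=
  fun 𝓑 _ _ h1 h2 h3 h4 h5 h6 ↦ h 𝓑 h1 h2 h3 h4 h5 (noImprisonedRay_of_noTrappedRayModOrbit 𝓑 h6)

/-- **FullRigidity → C‴** and hence **typed → C‴ modulo non-imprisonment**. -/
theorem modFlow_of_fullRigidityGH (h : FullRigidityGH) : ZeroEnergyRigidityModFlow :=
  fun 𝓑 _ _ h1 h2 h3 h4 h5 _ ↦ h 𝓑 h1 h2 h3 h4 h5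

theorem modFlow_of_zeroEnergyRigidity (hfree : NoImprisonedRayIsFree) (h : ZeroEnergyRigidity) :
    ZeroEnergyRigidityModFlow :=
  modFlow_of_fullRigidityGH ((zeroEnergyRigidity_iff_fullRigidityGH hfree).mp h)

/-! ## (F4) Junk survey (why no in-tree witness refutes the crux or its hypothesis-drops) -/

/-- **Junk survey** (no Lean content; `True`).  Candidate witnesses examined, with the hypothesis
that kills each — all computed on paper from the definitions `docOfEnd = I⁺(M_ext) ∩ I⁻(M_ext)`,
`futureEventHorizonOfEnd = ∂I⁻(M_ext) ∩ I⁺(M_ext)`, `IsGloballyHyperbolic = causal ∧ compact J-diamonds`: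

1. Minkowski `ℝ⁴`, `T = ∂ₜ`: `I^±(M_ext) = ℝ⁴`, horizon `= ∅` — killed by h2 (`IsConnected` ⇒ non-empty).
   Any other complete Killing `T'` timelike on a whole AF end is a time translation (boost/rotation
   parts fail far out), so no Rindler-type "horizon" can be presented.
2. `Kerr.stationaryAFBlackHoleOn 0 0 r₀` (punctured Minkowski `{‖x⃗‖ > max r₀ 0}`): horizon `∅` (h2)
   and NOT globally hyperbolic (timelike cylinder / deleted axis: diamonds leak) (h4).
3. Exterior-only chart `r₀ = r₊`: horizon `∅` (h2); moreover its conclusion is TRUE (doc = carrier =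
   Kerr exterior), so it witnesses nothing even with h2 dropped.
4. White-hole / time-reversed charts: future horizon `∅` (the `r = r₊` sheet is then a past horizon).
5. Super-extremal `|a| > M`: no horizon (h2); charts `{r > r₀ > 0}` have a timelike boundary, `{r > 0}`
   deletes the regular open disc — both non-GH (h4).
6. Extremal `|a| = M`: κ = 0 for the only horizon-generating Killing field `T + Ω_H Φ` (h3); and every
   horizon-penetrating Kerr–Schild chart `{r > r₀}`, `0 ≤ r₀ < M`, is non-GH (Δ = (r−M)² > 0 inside:
   `{r = r₀}` timelike, or the disc is deleted) — so the in-tree extremal family does not even witness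
   the necessity of h3 under h4.  NOT CLAIMED: `¬ (crux without h3)`.
7. Sub-extremal charts reaching below `r₋` (`max r₀ 0 < r₋`): non-GH (disc deleted for `a ≠ 0`;
   NB `t*` is a time function on all of `{r > 0}` since `g^{t*t*} = −1 − 2H < 0`, so causality holds —
   the failure is non-compact diamonds through the deleted disc, not a Cauchy horizon in the chart).
8. `t*`-periodic quotient Kerr/ℤ_L of a black-hole chart: h1, h2 (horizon `S¹ × S²`), h3, h5 hold, h6
   holds (future zero-energy rays plunge: `R(r) = a²L² − Δ(L²+Q)` strictly decreasing on `r > M`), the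
   conclusion FAILS (π₁(doc) = ℤ vs the simply connected Kerr exterior; a bijective immersion between
   4-manifolds is a homeomorphism) — killed ONLY by h4 (closed timelike curves).  h4 is load-bearing.
9. Kerr–Newman `Q ≠ 0`: all of h2–h6, conclusion false (local geometry), killed only by h1.
10. Proper `T`-invariant open sub-carriers `U` of a sub-extremal black-hole chart with `U ⊇ M_ext`:
    if `U` is GH then `U ⊇ {r > r₊}` (take `z ∈ {r>r₊} ∖ U` of maximal `r`; timelike curves in
    `{r > r(z)} ⊆ U` through points next to `z` give a `U`-diamond accumulating at `z ∉ U`), hence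
    `doc_U = {r > r₊}` and the conclusion still holds — sub-presentations cannot exploit the "FULL
    Kerr exterior" form of the conclusion.  Carving the black-hole interior (e.g. `U = I⁻(T·p₀)`, `p₀`
    an interior axis point) keeps h1–h6 (h3 needs the carved horizon `Φ`-invariant: axis point) and
    keeps `doc_U = {r > r₊}`: conclusion true.
11. Constant curves: excluded from h6 by `IsNull`'s clause `v ≠ 0`; h6 is not vacuous-making.
12. `Kerr.Facts` (connectedness of `{r > max r₀ 0}`; analyticity of `g = η + 2Hℓ⊗ℓ` and of `−g♯dt*`
    on `{r > 0}` for ALL real `M, a, r₀`): true (the inner radicand `(ρ²−a²)² + 4a²z²` vanishes only on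
    the ring `r = 0`; for `a = 0` only on the axis `ρ = 0 = r`), so no `False` from the instance binder.

13. Antipodal quotient Kerr/ℤ₂ by `(θ, φ) ↦ (π − θ, φ + π)` (free isometry commuting with `T`, `Φ`):
    smooth, Ricci-flat, stationary, causal (`t*` is preserved by the involution and is a time
    function) and GH, horizon `ℝ × ℝP²` connected non-degenerate, doc `≅ ℝ² × ℝP²` NOT a Kerr exterior
    — but it is NOT a `StationaryAFBlackHole`: its slice end `(R,∞) × ℝP²` carries no `AFEnd` (an AF
    chart `{‖y‖ > R} ⊆ ℝ³` forces Euclidean volume growth `(4π/3)ρ³` of the region inside the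
    coordinate spheres, the quotient end has half of it; equivalently the two lifts of the chart
    region would be disjoint AF ends of the Kerr slice).  Killed by the structure (asymptotic
    flatness with `S²` coordinate spheres), not by h1–h6.
14. Ionescu–Klainerman local stationary hair (barrier `IonescuKlainermanNonExtension`, JAMS 2013
    Thm 1.3): smooth Ricci-flat `T`-invariant modifications of Kerr near ONE horizon point; their
    `T`-saturation is a strip, not a `T`-invariant neighbourhood of the horizon, and no global AF
    completion is known (barrier scope_caveat (a)) — not a witness.  Conversely Petersen 2021
    (Thm 1.17, evasion (4) of that barrier): for `M = I⁺(M_ext)` and non-zero constant surface gravity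
    the horizon IS a Killing horizon on a stationary neighbourhood — so the COLLAR form of h3 is close
    to derivable, supporting the recommended localisation (F5) rather than the global h3.

Genuine inhabitant of h1–h6: `Kerr.stationaryAFBlackHoleOn M a r₀`, `|a| < M`, `r₋ ≤ max r₀ 0 < r₊`
(boundary `{r = r₀}` spacelike inside the hole ⇒ GH), modulo the un-vendored identifications
`doc = {r > r₊}`, `𝓔⁺ = {r = r₊}`, Ricci-flatness and GH of the chart; there the conclusion holds with
`Ψ =` the `Opens` inclusion `Kerr.exterior M a ↪ Kerr.region a r₀`.  So the hypotheses are jointly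
satisfiable and the crux is not vacuous. -/
theorem junk_survey : True := trivial

/-! ## (b) Tightness (landed: `Theorems/ZeroEnergyRigidity/Negative/KerrParameterSign.lean`, p73548) -/

/-- **(b) pointer** (landed p73548, commit 5e9cea9d13f9, sorry-free, rc 0; namespace
`Summit.FinalStateConjecture.FinalStateConjecture.Theorems.ZeroEnergyRigidity.Negative`).  With
`KerrExteriorPresentation 𝓑 M a := ∃ Ψ : Kerr.exterior M a → 𝓑, Injective Ψ ∧ range Ψ = doc ∧
IsIsometricImmersion (Kerr.smoothMetric M a r₊) 𝓑.metric Ψ` (so `KerrConclusion 𝓑 ↔ ∃ M a,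
IsSubextremal M a ∧ KerrExteriorPresentation 𝓑 M a` by `Iff.rfl`):
* `isIsometricImmersion_reflExt : IsIsometricImmersion (Kerr.smoothMetric M (−a) r₊) (Kerr.smoothMetric M a r₊) (reflExt M a)`
  — the reflection `(t*,x,y,z) ↦ (t*,x,−y,z)`, a bijection of the exteriors; mechanism
  `g_{M,−a}(Ry)(Rv,Rw) = g_{M,a}(y)(v,w)` (`r`, `H` depend on `a²`; `ℓ₂` flips sign with `y` and `a`);
* `kerrExteriorPresentation_neg_iff : KerrExteriorPresentation 𝓑 M (−a) ↔ KerrExteriorPresentation 𝓑 M a`;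
* `exists_kerrExteriorPresentation_iff_nonneg` — normal form `0 ≤ a` of the crux conclusion.
Corollaries (pure logic from the above, to be kernel-linked here in cycle 2): the crux conclusion is
equivalent to its `0 ≤ a` form; and for a rotating presentation (`a ≠ 0`) the strengthening
`∃! (M, a)` is FALSE (uniqueness would give `(M,a) = (M,−a)`).  Uniqueness of `M` and `|a|` (ADM mass /
angular momentum) is the expected truth and is neither claimed nor refuted. -/
theorem tightness_pointer : True := trivial


/-! ## (b″, cycle 3) Tightness II: the d.o.c. isometry `Ψ` of the conclusion is never unique -/

/-- **(b″) pointer** (file `KerrTimeTranslation.lean`, PROPOSED p78657 (review-queued, D-0009: new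
defs) for `Theorems/ZeroEnergyRigidity/Negative/`; sorry-free, rc 0, 0 warnings, axioms
{propext, Classical.choice, Quot.sound}; namespace `…Theorems.ZeroEnergyRigidity.Negative`).
The Killing time translation `shiftT c : (t*, x⃗) ↦ (t* + c, x⃗)` preserves `r`, `H`, `ℓ` (functions
of `x⃗` only), hence the Kerr–Schild form (`bilin_shiftT`), restricts to a smooth bijection
`shiftExt a r₀ c` of every chart `Kerr.region a r₀` with identity differential
(`mfderiv_shiftExt`), an isometric immersion of `Kerr.smoothMetric M a r₀` onto itself
(`isIsometricImmersion_shiftExt`).  Consequently, for EVERY `𝓑`, `M`, `a`: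
* `kerrExteriorPresentation_comp_shiftExt` — `Ψ ∘ shiftExt a r₊ c` presents the d.o.c. whenever
  `Ψ` does;
* `not_existsUnique_kerrExteriorPresentation : ¬ ∃! Ψ, Injective Ψ ∧ range Ψ = doc ∧
  IsIsometricImmersion (Kerr.smoothMetric M a r₊) 𝓑.metric Ψ` — the `∃ Ψ` of the conclusion can
  never be sharpened to `∃! Ψ` (`Ψ ∘ shiftExt a r₊ 1 ≠ Ψ`: `Ψ` injective, the exterior non-empty by
  `[Kerr.Facts]`, and `t* ↦ t* + 1` moves every point);
* `exists_ne_of_kerrExteriorPresentation` — two distinct presentations from one.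
With (b′) (parameters fixed at most up to `a ↦ −a`) and (F10) (normalisation of `T` free) this
closes the list of rigidifications of the conclusion that hold for free: none — equivariance
`dΨ(∂_{t*}) = T`, a marked point, or a matched slice must be IMPOSED by a strengthened statement,
and then (F10)'s caveat applies. -/
theorem tightness_pointer2 : True := trivial

/-! ## (F8, cycle 2) h5 is redundant: `H4 → H5` — kernel-checked -/

/-- Chronology of the carrier already forces `T ≠ 0` on the d.o.c.: a zero `p ∈ doc` of the
complete Killing field `T` is a compact flow-invariant subset of the d.o.c., which Chruściel–Costa's
Lemma 3.7 (finite `I⁺`-cover + pigeonhole) turns into a closed timelike curve.  Both steps are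
PROVED in the tree (`StationaryAFBlackHole.killing_ne_zero_of_mem_doc`, CC08 Cor. 3.8, in
`Literature.Geometry.Lorentzian.StationaryBlackHoleUniquenessProofs`; flow = isometries from
`KillingFlowIsometry`); this is the three-line assembly. -/
theorem h5_of_isChronological (𝓑 : StationaryAFBlackHole.{0}) [𝓑.metric.HasLeviCivita]
    (h : 𝓑.metric.IsChronological 𝓑.timeOrientation) : H5 𝓑 :=
  fun _ hp ↦ StationaryAFBlackHole.killing_ne_zero_of_mem_doc
    (fun q _ ↦ (LorentzianMetric.isChronological_iff.mp h) q) hp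

/-- **(F8)** `H4 → H5` for EVERY presentation: global hyperbolicity ⊇ causality ⊇ chronology.
Only the chronology clause of h4 is used. -/
theorem h5_of_h4 (𝓑 : StationaryAFBlackHole.{0}) [𝓑.metric.HasLeviCivita] (h4 : H4 𝓑) :
    H5 𝓑 :=
  h5_of_isChronological 𝓑 h4.isCausallyWellBehaved.isChronological

/-- The crux with h5 deleted (h6 kept verbatim). -/
def ZeroEnergyRigidityWithoutH5 : Prop :=
  ∀ (𝓑 : StationaryAFBlackHole.{0}) [𝓑.metric.HasLeviCivita] [Kerr.Facts],
    H1 𝓑 → H2 𝓑 → H3 𝓑 → H4 𝓑 → NoImprisonedRay 𝓑 → KerrConclusion 𝓑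

/-- **(F8)** Unconditionally (no named fact): the typed crux is equivalent to itself with h5
deleted.  h5 is decoration. -/
theorem zeroEnergyRigidity_iff_withoutH5 : ZeroEnergyRigidity ↔ ZeroEnergyRigidityWithoutH5 :=
  ⟨fun h 𝓑 _ _ h1 h2 h3 h4 h6 ↦ h 𝓑 h1 h2 h3 h4 (h5_of_h4 𝓑 h4) h6,
    fun h 𝓑 _ _ h1 h2 h3 h4 _ h6 ↦ h 𝓑 h1 h2 h3 h4 h6⟩

/-- The CORE statement: h5 and h6 both deleted — smooth stationary vacuum black-hole uniqueness
with a global horizon Killing field (F3), under global hyperbolicity of the carrier and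
connectedness of `𝓔⁺`, with NO `I⁺`-regularity. -/
def CoreRigidityGH : Prop :=
  ∀ (𝓑 : StationaryAFBlackHole.{0}) [𝓑.metric.HasLeviCivita] [Kerr.Facts],
    H1 𝓑 → H2 𝓑 → H3 𝓑 → H4 𝓑 → KerrConclusion 𝓑

/-- `FullRigidityGH` (h6 deleted) is already the core (h5 is implied by h4). -/
theorem fullRigidityGH_iff_core : FullRigidityGH ↔ CoreRigidityGH :=
  ⟨fun h 𝓑 _ _ h1 h2 h3 h4 ↦ h 𝓑 h1 h2 h3 h4 (h5_of_h4 𝓑 h4),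
    fun h 𝓑 _ _ h1 h2 h3 h4 _ ↦ h 𝓑 h1 h2 h3 h4⟩

/-- **(F2) + (F8)**: modulo non-imprisonment the typed crux IS `CoreRigidityGH` — the served
statement reads `∀ 𝓑, vacuum → 𝓔⁺ connected → 𝓔⁺ non-degenerate (global K) → GH → d.o.c. = Kerr`. -/
theorem zeroEnergyRigidity_iff_core (hfree : NoImprisonedRayIsFree) :
    ZeroEnergyRigidity ↔ CoreRigidityGH :=
  (zeroEnergyRigidity_iff_fullRigidityGH hfree).trans fullRigidityGH_iff_core

/-! ## (b′, cycle 2) Tightness, kernel-linked to `Negative.KerrParameterSign` (landed p73548) -/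

section TightnessLinked

open Summit.FinalStateConjecture.FinalStateConjecture.Theorems.ZeroEnergyRigidity.Negative

variable (𝓑 : StationaryAFBlackHole.{0}) [Kerr.Facts]

/-- The crux conclusion is `∃ (M, a) sub-extremal, KerrExteriorPresentation 𝓑 M a` (`Iff.rfl`). -/
theorem kerrConclusion_iff_exists_presentation :
    KerrConclusion 𝓑 ↔ ∃ M a : ℝ, Kerr.IsSubextremal M a ∧ KerrExteriorPresentation 𝓑 M a :=
  Iff.rfl

/-- **(b′)** Normal form of the conclusion: the sign of `a` is redundant (`0 ≤ a` w.l.o.g.). -/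
theorem kerrConclusion_iff_nonneg :
    KerrConclusion 𝓑 ↔
      ∃ M a : ℝ, Kerr.IsSubextremal M a ∧ 0 ≤ a ∧ KerrExteriorPresentation 𝓑 M a :=
  exists_kerrExteriorPresentation_iff_nonneg 𝓑

/-- **(b′) Refuted strengthening `∃!`.**  For a ROTATING presentation the parameters of the
conclusion are not unique: `(M, a)` and `(M, −a)` both present the d.o.c. (reflection `y ↦ −y`,
`kerrExteriorPresentation_neg`), so `∃! (M, a)` would force `a = −a`.  (Uniqueness of `M` and
`|a|` — ADM mass and angular momentum — is the expected truth; neither claimed nor refuted.) -/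
theorem not_existsUnique_params_of_rotating {M a : ℝ} (hMa : Kerr.IsSubextremal M a) (ha : a ≠ 0)
    (h : KerrExteriorPresentation 𝓑 M a) :
    ¬ ∃! p : ℝ × ℝ, Kerr.IsSubextremal p.1 p.2 ∧ KerrExteriorPresentation 𝓑 p.1 p.2 := by
  rintro ⟨p, -, huniq⟩
  have h₁ : (M, a) = p := huniq (M, a) ⟨hMa, h⟩
  have h₂ : (M, -a) = p :=
    huniq (M, -a) ⟨(isSubextremal_neg_iff M a).2 hMa, kerrExteriorPresentation_neg 𝓑 h⟩
  have h₃ : a = -a := by simpa using congrArg Prod.snd (h₁.trans h₂.symm)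
  exact ha (by linarith)

end TightnessLinked

/-! ## (F9, cycle 2) h3 fixes neither the orientation nor the scale of its Killing field -/

section HorizonScaling

variable (𝓑 : StationaryAFBlackHole.{0}) [𝓑.metric.HasLeviCivita]

/-- Constant multiples of Killing fields are Killing fields (the Killing equation is linear:
`∇(c • K) = c • ∇K` by `IsCovariantDerivativeOn.smul_const`, and `g` is bilinear). -/
theorem isKillingField_smul {K : Π x : 𝓑.carrier, TangentSpace (𝓡 4) x}
    (hK : 𝓑.metric.IsKillingField K) (c : ℝ) : 𝓑.metric.IsKillingField (c • K) := by
  refine ⟨hK.contMDiff.const_smul_section, fun x Y₀ Z₀ ↦ ?_⟩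
  have hKx : MDifferentiableAt (𝓡 4) (𝓡 4).tangent
      (fun y ↦ (⟨y, K y⟩ : TangentBundle (𝓡 4) 𝓑.carrier)) x :=
    (hK.contMDiff x).mdifferentiableAt (by simp)
  have hs : 𝓑.metric.leviCivita (c • K) x = c • 𝓑.metric.leviCivita K x :=
    𝓑.metric.leviCivita.isCovariantDerivativeOnUniv.smul_const c hKx
  have h := hK.val_leviCivita_add x Y₀ Z₀
  simp only [hs, FunLike.coe_smul, Pi.smul_apply, map_smul, smul_eq_mul]
  linear_combination c * h

/-- **(F9)** If `(K, κ)` witnesses `IsNonDegenerateHorizon` (h3) then so does `(c • K, c κ)` for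
every `c ≠ 0`: the four clauses of h3 transported along `K ↦ c • K`.  Integral curves of `c • K`
are the reparametrised integral curves of `K` (`IsMIntegralCurve.comp_mul`), and
`∇_{cK}(cK) = c² ∇_K K = (cκ)(cK)`. -/
theorem h3Witness_smul {K : Π x : 𝓑.carrier, TangentSpace (𝓡 4) x} {κ : ℝ}
    (hK : 𝓑.metric.IsKillingField K) (hne : ∀ p ∈ 𝓑.horizon, K p ≠ 0)
    (htan : ∀ γ : ℝ → 𝓑.carrier, IsMIntegralCurve γ K → γ 0 ∈ 𝓑.horizon → ∀ t, γ t ∈ 𝓑.horizon)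
    (hgeod : ∀ p ∈ 𝓑.horizon, 𝓑.metric.leviCivita K p (K p) = κ • K p) {c : ℝ} (hc : c ≠ 0) :
    𝓑.metric.IsKillingField (c • K) ∧ (∀ p ∈ 𝓑.horizon, (c • K) p ≠ 0) ∧
      (∀ γ : ℝ → 𝓑.carrier, IsMIntegralCurve γ (c • K) → γ 0 ∈ 𝓑.horizon →
        ∀ t, γ t ∈ 𝓑.horizon) ∧
      ∀ p ∈ 𝓑.horizon, 𝓑.metric.leviCivita (c • K) p ((c • K) p) = (c * κ) • (c • K) p := by
  refine ⟨isKillingField_smul 𝓑 hK c, fun p hp ↦ ?_, fun γ hγ h0 t ↦ ?_, fun p hp ↦ ?_⟩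
  · simpa [hc] using hne p hp
  · have hγ' : IsMIntegralCurve (γ ∘ (· * c⁻¹)) K := by
      simpa [smul_smul, inv_mul_cancel₀ hc] using hγ.comp_mul c⁻¹
    have h := htan _ hγ' (by simpa using h0) (t * c)
    simpa [mul_assoc, mul_inv_cancel₀ hc] using h
  · have hKx : MDifferentiableAt (𝓡 4) (𝓡 4).tangent
        (fun y ↦ (⟨y, K y⟩ : TangentBundle (𝓡 4) 𝓑.carrier)) p :=
      (hK.contMDiff p).mdifferentiableAt (by simp)
    have hs : 𝓑.metric.leviCivita (c • K) p = c • 𝓑.metric.leviCivita K p :=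
      𝓑.metric.leviCivita.isCovariantDerivativeOnUniv.smul_const c hKx
    rw [hs, Pi.smul_apply, FunLike.coe_smul, Pi.smul_apply, map_smul, hgeod p hp,
      smul_smul, smul_smul, smul_smul]
    congr 1
    ring

/-- **(F9), corollary.**  h3 is equivalent to h3 with a POSITIVE surface gravity and to h3 with a
NEGATIVE one: the unoriented `κ` of the telescope carries exactly the bit `κ ≠ 0`.  Consequently
"the horizon generator is future-directed with `κ > 0`" (needed by every collar / Hawking-step
docking) is NOT a reading of h3 but a claim to be proved after orienting `K` (see (F11)). -/
theorem h3_iff_exists_pos_kappa :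
    H3 𝓑 ↔ ∃ K : Π x : 𝓑.carrier, TangentSpace (𝓡 4) x, 𝓑.metric.IsKillingField K ∧
      (∀ p ∈ 𝓑.horizon, K p ≠ 0) ∧
      (∀ γ : ℝ → 𝓑.carrier, IsMIntegralCurve γ K → γ 0 ∈ 𝓑.horizon → ∀ t, γ t ∈ 𝓑.horizon) ∧
      ∃ κ : ℝ, 0 < κ ∧ ∀ p ∈ 𝓑.horizon, 𝓑.metric.leviCivita K p (K p) = κ • K p := by
  constructor
  · rintro ⟨K, hK, hne, htan, κ, hκ, hgeod⟩
    rcases lt_or_gt_of_ne hκ with hneg | hpos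
    · obtain ⟨hK', hne', htan', hgeod'⟩ :=
        h3Witness_smul 𝓑 hK hne htan hgeod (neg_ne_zero.2 one_ne_zero : (-1 : ℝ) ≠ 0)
      exact ⟨(-1 : ℝ) • K, hK', hne', htan', -1 * κ, by linarith, hgeod'⟩
    · exact ⟨K, hK, hne, htan, κ, hpos, hgeod⟩
  · rintro ⟨K, hK, hne, htan, κ, hκ, hgeod⟩
    exact ⟨K, hK, hne, htan, κ, hκ.ne', hgeod⟩

theorem h3_iff_exists_neg_kappa :
    H3 𝓑 ↔ ∃ K : Π x : 𝓑.carrier, TangentSpace (𝓡 4) x, 𝓑.metric.IsKillingField K ∧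
      (∀ p ∈ 𝓑.horizon, K p ≠ 0) ∧
      (∀ γ : ℝ → 𝓑.carrier, IsMIntegralCurve γ K → γ 0 ∈ 𝓑.horizon → ∀ t, γ t ∈ 𝓑.horizon) ∧
      ∃ κ : ℝ, κ < 0 ∧ ∀ p ∈ 𝓑.horizon, 𝓑.metric.leviCivita K p (K p) = κ • K p := by
  rw [h3_iff_exists_pos_kappa]
  constructor
  · rintro ⟨K, hK, hne, htan, κ, hκ, hgeod⟩
    obtain ⟨hK', hne', htan', hgeod'⟩ :=
      h3Witness_smul 𝓑 hK hne htan hgeod (neg_ne_zero.2 one_ne_zero : (-1 : ℝ) ≠ 0)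
    exact ⟨(-1 : ℝ) • K, hK', hne', htan', -1 * κ, by linarith, hgeod'⟩
  · rintro ⟨K, hK, hne, htan, κ, hκ, hgeod⟩
    obtain ⟨hK', hne', htan', hgeod'⟩ :=
      h3Witness_smul 𝓑 hK hne htan hgeod (neg_ne_zero.2 one_ne_zero : (-1 : ℝ) ≠ 0)
    exact ⟨(-1 : ℝ) • K, hK', hne', htan', -1 * κ, by linarith, hgeod'⟩

end HorizonScaling

/-! ## (F10, cycle 2) The normalisation of `T` is free — kernel-checked -/

section Rescale

/-- Orbits of `c • V` are the orbits of `V` (`c ≠ 0`): the integral curves are reparametrised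
(`IsMIntegralCurve.comp_mul`). -/
theorem stationaryOrbit_const_smul {M : Type*} [TopologicalSpace M] [ChartedSpace E4 M]
    (V : Π x : M, TangentSpace (𝓡 4) x) {c : ℝ} (hc : c ≠ 0) (A : Set M) :
    stationaryOrbit (c • V) A = stationaryOrbit V A := by
  ext y
  constructor
  · rintro ⟨γ, hγ, h0, t, rfl⟩
    refine ⟨γ ∘ (· * c⁻¹), ?_, by simpa using h0, t * c, by simp [mul_assoc, mul_inv_cancel₀ hc]⟩
    simpa [smul_smul, inv_mul_cancel₀ hc] using hγ.comp_mul c⁻¹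
  · rintro ⟨γ, hγ, h0, t, rfl⟩
    exact ⟨γ ∘ (· * c), hγ.comp_mul c, by simpa using h0, t * c⁻¹,
      by simp [mul_assoc, inv_mul_cancel₀ hc]⟩

variable (𝓑 : StationaryAFBlackHole.{0}) {c : ℝ} (hc : 0 < c)

/-- **(F10)** `𝓑` with its stationary field replaced by `c • T`, `c > 0`, is again a
`StationaryAFBlackHole` — same spacetime, slice, data, AF end, embedding and normal: the structure
normalises `T` nowhere (`g(T,T) → −1` at infinity is NOT a field). -/
def rescale : StationaryAFBlackHole.{0} :=
  { 𝓑 with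
    killing := c • 𝓑.killing
    isStationary := by
      intro _
      refine ⟨isKillingField_smul 𝓑 𝓑.isStationary.isKillingField c, fun x ↦ ?_,
        fun x hx ↦ ?_⟩
      · obtain ⟨γ, hγ, h0⟩ := 𝓑.isStationary.isCompleteVectorField x
        exact ⟨γ ∘ (· * c), hγ.comp_mul c, by simpa using h0⟩
      · rw [stationaryOrbit_const_smul _ hc.ne'] at hx
        obtain ⟨ht, hf⟩ := 𝓑.isStationary.isTimelike hx
        have ht' : 𝓑.metric.val x (c • 𝓑.killing x) (c • 𝓑.killing x) < 0 := by
          have : 𝓑.metric.val x (c • 𝓑.killing x) (c • 𝓑.killing x) =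
              c * c * 𝓑.metric.val x (𝓑.killing x) (𝓑.killing x) := by
            simp only [map_smul, FunLike.coe_smul, Pi.smul_apply, smul_eq_mul]; ring
          rw [this]
          exact mul_neg_of_pos_of_neg (mul_pos hc hc) ht
        refine ⟨ht', ⟨ht'.le, ?_⟩, ?_⟩
        · exact smul_ne_zero hc.ne' hf.1.2
        · have : 𝓑.metric.val x (𝓑.timeOrientation.vectorField x) (c • 𝓑.killing x) =
              c * 𝓑.metric.val x (𝓑.timeOrientation.vectorField x) (𝓑.killing x) := by
            simp only [map_smul, smul_eq_mul]
          rw [Pi.smul_apply, this]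
          exact mul_neg_of_pos_of_neg hc hf.2 }

@[simp] theorem rescale_toSpacetime : (rescale 𝓑 hc).toSpacetime = 𝓑.toSpacetime := rfl
@[simp] theorem rescale_killing : (rescale 𝓑 hc).killing = c • 𝓑.killing := rfl

/-- The metric is untouched, so the standing Levi-Civita hypothesis transfers (by `rfl`). -/
instance rescale_hasLeviCivita {𝓑 : StationaryAFBlackHole.{0}} {c : ℝ} {hc : 0 < c}
    [h : 𝓑.metric.HasLeviCivita] : (rescale 𝓑 hc).metric.HasLeviCivita := h

/-- Same `M_ext` (as a set). -/
@[simp] theorem rescale_Mext : (rescale 𝓑 hc).Mext = 𝓑.Mext :=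
  stationaryOrbit_const_smul _ hc.ne' _

/-- Same d.o.c. -/
@[simp] theorem rescale_doc : (rescale 𝓑 hc).doc = 𝓑.doc := by
  simp only [StationaryAFBlackHole.doc, rescale_Mext]; rfl

/-- Same future event horizon. -/
@[simp] theorem rescale_horizon : (rescale 𝓑 hc).horizon = 𝓑.horizon := by
  simp only [StationaryAFBlackHole.horizon, rescale_Mext]; rfl

/-- **(F10)** Every hypothesis and the conclusion of the crux are invariant under `T ↦ c • T`:
the instance of `ZeroEnergyRigidity` at `rescale 𝓑 hc` is the instance at `𝓑`.  Hence no proof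
can extract a normalisation of `T` from h1–h6, and a `T`-equivariant strengthening of the
conclusion (`dΨ(∂_{t*}) = T`) is not provable as typed (it fails at `rescale 𝓑 2` whenever it holds
at `𝓑`). -/
theorem telescope_rescale_iff [𝓑.metric.HasLeviCivita] [Kerr.Facts] :
    (H1 (rescale 𝓑 hc) → H2 (rescale 𝓑 hc) → H3 (rescale 𝓑 hc) → H4 (rescale 𝓑 hc) →
        H5 (rescale 𝓑 hc) → NoImprisonedRay (rescale 𝓑 hc) → KerrConclusion (rescale 𝓑 hc)) ↔
      (H1 𝓑 → H2 𝓑 → H3 𝓑 → H4 𝓑 → H5 𝓑 → NoImprisonedRay 𝓑 → KerrConclusion 𝓑) := by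
  have h2 : H2 (rescale 𝓑 hc) ↔ H2 𝓑 := by rw [H2, H2, rescale_horizon]; exact Iff.rfl
  have h3 : H3 (rescale 𝓑 hc) ↔ H3 𝓑 := by
    rw [H3, H3, rescale_Mext]; rfl
  have h5 : H5 (rescale 𝓑 hc) ↔ H5 𝓑 := by
    simp only [H5, rescale_doc, rescale_killing, Pi.smul_apply]
    exact forall₂_congr fun p _ ↦
      ⟨fun h h0 ↦ h (by rw [h0, smul_zero]; rfl), fun h ↦ smul_ne_zero hc.ne' h⟩
  have h6 : NoImprisonedRay (rescale 𝓑 hc) ↔ NoImprisonedRay 𝓑 := by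
    have hz : ∀ (x : 𝓑.carrier) (v : TangentSpace (𝓡 4) x),
        𝓑.metric.val x (c • 𝓑.killing x) v = 0 ↔ 𝓑.metric.val x (𝓑.killing x) v = 0 := by
      intro x v
      simp only [map_smul, FunLike.coe_smul, Pi.smul_apply, smul_eq_mul, mul_eq_zero, hc.ne',
        false_or]
    unfold NoImprisonedRay
    rw [rescale_doc]
    refine forall₂_congr fun γ _ ↦ ?_
    change (∀ s : ℝ, 0 ≤ s → 𝓑.metric.IsNull (velocity (𝓡 4) γ s) ∧
        𝓑.metric.val (γ s) (c • 𝓑.killing (γ s)) (velocity (𝓡 4) γ s) = 0) → _ ↔ _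
    simp only [hz]
    exact Iff.rfl
  have hc' : KerrConclusion (rescale 𝓑 hc) ↔ KerrConclusion 𝓑 := by
    unfold KerrConclusion
    rw [rescale_doc]
    rfl
  have h1 : H1 (rescale 𝓑 hc) ↔ H1 𝓑 := Iff.rfl
  have h4 : H4 (rescale 𝓑 hc) ↔ H4 𝓑 := Iff.rfl
  rw [h1, h2, h3, h4, h5, h6, hc']

end Rescale

/-! ## (F11, cycle 2) Pre-triage of the ideator stubs (`SketchIdeator2.lean`) -/

/-- **(F11) Pre-triage of `SketchIdeator2.lean`** (no stub is filed yet; `payload.targets = []`).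

1. `HorizonKillingNormGradient` — `∀ 𝓑 K κ, Killing K → (∀ p ∈ 𝓔⁺, ∇_K K = κK) → ∀ p ∈ 𝓔⁺,
   g(K,K) = 0 ∧ dΦ(X) = −2κ g(K,X)`.  Conjunct 2 (pointwise) is the tree lemma
   `IsKillingField.val_leviCivita_eq_neg_mul_of_leviCivita_eq_smul` + metric compatibility of `∇`
   (`d(g(K,K))(X) = 2 g(∇_X K, K)`), fine for every `κ`.  Conjunct 1 is stated for EVERY `κ : ℝ`:
   for `κ ≠ 0` it is `horizonKilling_isNull` above (= tree
   `IsKillingField.val_self_eq_zero_of_leviCivita_eq_smul`); for `κ = 0` the Killing identity reads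
   `0 = 0` and yields nothing, so the stub asserts "a Killing field with geodesic orbits along `𝓔⁺`
   is null there" — not derivable by the card's argument (no in-tree countermodel either: in Kerr
   presentations `span{T, Φ} ∋ K` with `∇_K K = 0` on `{r = r₊}` forces `K ∝ T + Ω_H Φ`, null).
   SHARPEN: add `κ ≠ 0` (h3 carries it) — then the whole stub is two tree lemmas.
2. `TelescopeCollar` — `h1 → h2 → h3 → h4 → ∃ U ⊇ 𝓔⁺ open, K Killing, …, g(K,K) < 0 on U ∩ doc`.
   By (F9) h3's witness may be replaced by `−K`; orient `K` future-directed (constant along the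
   connected null hypersurface piece, h2).  Then near `p ∈ 𝓔⁺`: `Φ = g(K,K)` has `Φ = 0`,
   `dΦ = −2κ K♭ ≠ 0` on `𝓔⁺`, and along the past-pointing transverse null direction `−N`
   (`g(K,N) = −1`; the d.o.c. lies on the PAST side of the achronal boundary `∂I⁻(M_ext)`)
   `dΦ(−N) = −2κ`.  So the collar is K-timelike iff `κ > 0` for the future-directed generator; for
   `κ < 0` the branch `𝓔⁺` is of white-hole type w.r.t. `K` (Rácz–Wald bifurcation surface to the
   FUTURE, generators future-incomplete K-orbits) and the d.o.c. side is the K-SPACELIKE wedge —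
   the stub would be FALSE there.  No such presentation is known (Kruskal carvings: `{V > 0}` has
   `κ > 0`, `{U < 0}` has `𝓔⁺ = ∅`, removing the bifurcation sphere breaks h4), and none is refuted:
   RECOMMEND splitting the stub into (a) ORIENTATION LEMMA "h1–h4 (+h2) ⇒ the future-directed
   normalisation of h3's `K` has `κ > 0`" (the load-bearing, possibly hard part — it is where
   future-completeness of the generators of `∂I⁻(M_ext)` / absence of a carved bifurcation surface
   under h4 enters) and (b) the collar from (a) (inverse-function-theorem level).
3. `KerrStuffingRigidity` — no cheap kill: `S = ∅` gives `Ψ = id`; a pull-back `φ^* g_Kerr` by a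
   diffeomorphism supported in `T·S'` keeps `∂_{t*}` Killing only if `φ_* ∂_{t*} − ∂_{t*}` (a Killing
   field of Kerr vanishing on an open set) is zero, i.e. `φ` commutes with the flow, and is then
   absorbed by the conclusion's `Ψ`; Ionescu–Klainerman hair (barrier `IonescuKlainermanNonExtension`)
   is supported behind the horizon, not in a flow-compact part of `{r > r₊}`.  Genuine first lemma.
4. All three stubs are insensitive to (F8) (none uses h5) and to (F10). -/
theorem sketchIdeator2_pretriage : True := trivial
/-! ## (F12, cycle 3) Targets: pre-triage of the REGISTERED skeleton `Lines/global-horizon-killing-field.lean`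

Skeleton registered 2026-08-16T02:29:40Z (sha `fc1d2c40…`; five stubs `stub_regularRepresentation`,
`stub_nonRotatingUniqueness`, `stub_rotatingUniqueness`, `stub_kerrChartTransfer`,
`stub_docIsometryTransfer`; `payload.targets = []`, no `PICKED.md` yet).  Verdicts in
`targets_pretriage`; kernel-checked pieces: (T1) in the non-rotating branch the STATIONARY field is
null on the whole horizon (a one-point test deciding the branch), (T2) the dichotomy exhausts h3,
(T3) `DocIsometry` is REFLEXIVE — stub 1 holds with `𝓑' := 𝓑` at every `I⁺`-regular presentation, so
its entire content is the re-presentation of the NON-`I⁺`-regular ones (= the crux, see the verdict).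
The skeleton's predicates are restated VERBATIM under the same names (this file must not import a
sorried work file); `hF_holds`/`hP_holds`/`hres_holds`/`docOpens'`/`DocIsometry` likewise. -/

section Targets

variable (𝓑 : StationaryAFBlackHole.{0})

/-- VERBATIM copy of `Lines/global-horizon-killing-field.lean: IsNonRotating` (some non-zero constant
multiple of `T` is an h3-witness). -/
def IsNonRotating : Prop :=
  ∀ [𝓑.metric.HasLeviCivita], ∃ c : ℝ, c ≠ 0 ∧ 𝓑.metric.IsKillingField (c • 𝓑.killing) ∧
    (∀ p ∈ 𝓑.horizon, (c • 𝓑.killing) p ≠ 0) ∧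
    (∀ γ : ℝ → 𝓑.carrier, IsMIntegralCurve γ (c • 𝓑.killing) → γ 0 ∈ 𝓑.horizon →
      ∀ t, γ t ∈ 𝓑.horizon) ∧
    ∃ κ : ℝ, κ ≠ 0 ∧ ∀ p ∈ 𝓑.horizon,
      𝓑.metric.leviCivita (c • 𝓑.killing) p ((c • 𝓑.killing) p) = κ • (c • 𝓑.killing) p

/-- VERBATIM copy of `Lines/global-horizon-killing-field.lean: HasIndependentHorizonKilling` (an
h3-witness which is not a constant multiple of `T`). -/
def HasIndependentHorizonKilling : Prop :=
  ∀ [𝓑.metric.HasLeviCivita], ∃ K : Π x : 𝓑.carrier, TangentSpace (𝓡 4) x,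
    𝓑.metric.IsKillingField K ∧ (∀ p ∈ 𝓑.horizon, K p ≠ 0) ∧
    (∀ γ : ℝ → 𝓑.carrier, IsMIntegralCurve γ K → γ 0 ∈ 𝓑.horizon → ∀ t, γ t ∈ 𝓑.horizon) ∧
    (∃ κ : ℝ, κ ≠ 0 ∧ ∀ p ∈ 𝓑.horizon, 𝓑.metric.leviCivita K p (K p) = κ • K p) ∧
    ¬ ∃ c : ℝ, K = c • 𝓑.killing

/-- `I^+(S)` is open on the boundaryless carrier (skeleton's `hF_holds`, same proof). -/
theorem hF_holds : 𝓑.metric.isOpen_chronologicalFuture 𝓑.timeOrientation :=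
  LorentzianMetric.isOpen_chronologicalFuture_holds_of_boundaryless

/-- `I^-(S)` is open on the boundaryless carrier (skeleton's `hP_holds`). -/
theorem hP_holds : 𝓑.metric.isOpen_chronologicalPast 𝓑.timeOrientation :=
  LorentzianMetric.isOpen_chronologicalPast_holds_of_boundaryless

/-- Restrictions of smooth metrics to open sets are smooth (skeleton's `hres_holds`). -/
theorem hres_holds :
    PseudoRiemannianMetric.contMDiff_restrict (I := 𝓡 4) (n := (∞ : ℕ∞ω)) (M := 𝓑.carrier) :=
  PseudoRiemannianMetric.contMDiff_restrict_holds

/-- The d.o.c. as an open submanifold, facts discharged (skeleton's `docOpens'`). -/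
def docOpens' : TopologicalSpace.Opens 𝓑.carrier := 𝓑.docOpens (hF_holds 𝓑) (hP_holds 𝓑)

/-- VERBATIM copy of the skeleton's `DocIsometry 𝓑' 𝓑`: a smooth injective isometric immersion of
the open submanifold `⟨⟨M_ext'⟩⟩ ⊆ 𝓑'` (restricted metric) into `𝓑` with range exactly `𝓑.doc`. -/
def DocIsometry (𝓑' 𝓑 : StationaryAFBlackHole.{0}) : Prop :=
  ∃ Θ : docOpens' 𝓑' → 𝓑.carrier, Function.Injective Θ ∧ Set.range Θ = 𝓑.doc ∧
    PseudoRiemannianMetric.IsIsometricImmersion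
      (𝓑'.metric.restrict (hres_holds 𝓑') (docOpens' 𝓑')).toPseudoRiemannianMetric
      𝓑.metric.toPseudoRiemannianMetric Θ

/-- **(T3)** `DocIsometry` is reflexive: the inclusion `⟨⟨M_ext⟩⟩ ↪ 𝓑` is a smooth injective
isometric immersion of the restricted metric with range `doc` (`mfderiv` of the inclusion of an
open submanifold is the identity, `OpenSubmanifold.mfderiv_subtype_val`).  Consequence for stub 1
(`stub_regularRepresentation`): at an `I⁺`-regular non-degenerate vacuum presentation it holds with
`𝓑' := 𝓑`; its content is exactly the NON-`I⁺`-regular presentations. -/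
theorem docIsometry_refl : DocIsometry 𝓑 𝓑 := by
  refine ⟨Subtype.val, Subtype.val_injective, ?_, contMDiff_subtype_val, fun x ↦ ?_⟩
  · ext y
    simp only [Set.mem_range, Subtype.exists, exists_prop, exists_eq_right]
    rfl
  · ext v w
    rw [pullbackBilin_apply, Literature.Geometry.Manifold.OpenSubmanifold.mfderiv_subtype_val]
    rfl

/-- **(T4) Stub S5 PROVED as typed** (`stub_docIsometryTransfer` of the lead's RESHAPED skeleton,
2026-08-16 ≥ 02:50Z: arbitrary openness/restriction proofs `hF' hP' hres'`, no Levi-Civita binder;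
interface sanity of "d.o.c. isometry ∘ Kerr conclusion").  Corestrict `Ψ' : Kerr.exterior M a → 𝓑'`
to the open submanifold `⟨⟨M_ext'⟩⟩` (`range Ψ' = doc'`); smoothness is unchanged
(`ContMDiff.subtypeVal_comp_iff`), the differential is unchanged (`mfderiv_comp` +
`OpenSubmanifold.mfderiv_subtype_val`), so the corestriction is an isometric immersion into the
RESTRICTED metric; compose with `Θ` (`IsIsometricImmersion.comp`); the range is `Θ '' univ = doc`.
Transplant wrinkle: `Kerr.exterior M a` unfolds to `Kerr.region a (Kerr.rPlus M a)`; terms coming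
from the Kerr conclusion carry the latter spelling and `rw` is sensitive to it — the corestriction is
typed over `Kerr.region _ _` on purpose. -/
theorem docIsometryTransfer_gen (𝓑₁ 𝓑' : StationaryAFBlackHole.{0}) [Kerr.Facts]
    (hF' : 𝓑'.metric.isOpen_chronologicalFuture 𝓑'.timeOrientation)
    (hP' : 𝓑'.metric.isOpen_chronologicalPast 𝓑'.timeOrientation)
    (hres' : PseudoRiemannianMetric.contMDiff_restrict (I := 𝓡 4) (n := (∞ : ℕ∞ω))
      (M := 𝓑'.carrier))
    (hΘ : ∃ Θ : 𝓑'.docOpens hF' hP' → 𝓑₁.carrier,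
      Function.Injective Θ ∧ Set.range Θ = 𝓑₁.doc ∧
        PseudoRiemannianMetric.IsIsometricImmersion
          (𝓑'.metric.restrict hres' (𝓑'.docOpens hF' hP')).toPseudoRiemannianMetric
          𝓑₁.metric.toPseudoRiemannianMetric Θ)
    (h' : KerrConclusion 𝓑') : KerrConclusion 𝓑₁ := by
  obtain ⟨Θ, hΘinj, hΘrange, hΘiso⟩ := hΘ
  obtain ⟨M, a, hMa, Ψ', hΨinj, hΨrange, hΨiso⟩ := h'
  have hmem : ∀ y, Ψ' y ∈ 𝓑'.docOpens hF' hP' := fun y ↦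
    show Ψ' y ∈ 𝓑'.doc from hΨrange ▸ Set.mem_range_self y
  -- NB: `Kerr.exterior M a` unfolds to `Kerr.region a (Kerr.rPlus M a)`, the carrier of the Kerr
  -- metric; all terms coming from `hΨiso` live over the latter, so we type `Ψ''` there.
  obtain ⟨Ψ'', rfl⟩ :
      ∃ Ψ'' : Kerr.region a (Kerr.rPlus M a) → 𝓑'.docOpens hF' hP', Subtype.val ∘ Ψ'' = Ψ' :=
    ⟨fun y ↦ ⟨Ψ' y, hmem y⟩, rfl⟩
  have hΨrange' :
      Set.range (Subtype.val ∘ Ψ'' : Kerr.region a (Kerr.rPlus M a) → 𝓑'.carrier) = 𝓑'.doc :=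
    hΨrange
  have hsmooth : ContMDiff 𝓘(ℝ, E4) (𝓡 4) ∞ Ψ'' :=
    (ContMDiff.subtypeVal_comp_iff (𝓑'.docOpens hF' hP') Ψ'').mp hΨiso.1
  have hmf : ∀ y : Kerr.region a (Kerr.rPlus M a), mfderiv 𝓘(ℝ, E4) (𝓡 4) (Subtype.val ∘ Ψ'') y =
      mfderiv 𝓘(ℝ, E4) (𝓡 4) Ψ'' y := by
    intro y
    rw [mfderiv_comp y
        (Literature.Geometry.Manifold.OpenSubmanifold.mdifferentiableAt_subtype_val _)
        ((hsmooth y).mdifferentiableAt (by simp)),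
      Literature.Geometry.Manifold.OpenSubmanifold.mfderiv_subtype_val]
    exact ContinuousLinearMap.id_comp _
  have hiso'' : PseudoRiemannianMetric.IsIsometricImmersion
      (Kerr.smoothMetric M a (Kerr.rPlus M a)).toPseudoRiemannianMetric
      (𝓑'.metric.restrict hres' (𝓑'.docOpens hF' hP')).toPseudoRiemannianMetric Ψ'' := by
    refine ⟨hsmooth, fun y ↦ ?_⟩
    have h2 := hΨiso.2 y
    ext v w
    have h3 := congrArg (fun B ↦ B v w) h2
    simp only [pullbackBilin_apply] at h3 ⊢
    rw [hmf y] at h3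
    exact h3
  have hsurj : Function.Surjective Ψ'' := by
    rintro ⟨x, hx⟩
    have hx' : x ∈ Set.range (Subtype.val ∘ Ψ'' : Kerr.region a (Kerr.rPlus M a) → _) := by
      rw [hΨrange']; exact hx
    obtain ⟨y, hy⟩ := hx'
    exact ⟨y, Subtype.ext hy⟩
  refine ⟨M, a, hMa, Θ ∘ Ψ'', hΘinj.comp (fun y₁ y₂ h ↦ hΨinj (congrArg Subtype.val h)), ?_,
    hΘiso.comp hiso''⟩
  show Set.range (Θ ∘ Ψ'' : Kerr.region a (Kerr.rPlus M a) → 𝓑₁.carrier) = 𝓑₁.doc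
  rw [Set.range_comp, hsurj.range_eq, Set.image_univ, hΘrange]

/-- (T4), `DocIsometry` form (the planner's original stub 5): one line from the general form. -/
theorem docIsometryTransfer (𝓑₁ 𝓑' : StationaryAFBlackHole.{0}) [Kerr.Facts]
    (hΘ : DocIsometry 𝓑' 𝓑₁) (h' : KerrConclusion 𝓑') : KerrConclusion 𝓑₁ :=
  docIsometryTransfer_gen 𝓑₁ 𝓑' (hF_holds 𝓑') (hP_holds 𝓑') (hres_holds 𝓑') hΘ h'

/-- **(T5) Stub S4 PROVED as typed** (`stub_kerrChartTransfer`, reshaped signature: no Levi-Civita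
binder; the vendored conclusion `IsIsometricToKerrExterior hF hP hres` — a `Diffeomorph Φ` of
`⟨⟨M_ext⟩⟩` onto `Kerr.exterior M a` which is an `IsIsometry` of the restricted metric — yields the
fact-free chart form).  `Ψ := Subtype.val ∘ Φ.symm`; `Φ.symm` is an isometric immersion INTO the
restricted metric because `Φ.symm^* (Φ^* g_Kerr) = (Φ ∘ Φ.symm)^* g_Kerr = g_Kerr`
(`pullbackBilin_comp`, `pullbackBilin_id`) and `Φ^* g_Kerr = g|doc` is the `IsIsometry` clause; the
inclusion is an isometric immersion of the restricted metric (T3's computation); compose.  Works for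
ARBITRARY proofs `hF hP hres`. -/
theorem kerrChartTransfer (𝓑₁ : StationaryAFBlackHole.{0}) [Kerr.Facts]
    (hF : 𝓑₁.metric.isOpen_chronologicalFuture 𝓑₁.timeOrientation)
    (hP : 𝓑₁.metric.isOpen_chronologicalPast 𝓑₁.timeOrientation)
    (hres : PseudoRiemannianMetric.contMDiff_restrict (I := 𝓡 4) (n := (∞ : ℕ∞ω))
      (M := 𝓑₁.carrier))
    (h : 𝓑₁.IsIsometricToKerrExterior hF hP hres) : KerrConclusion 𝓑₁ := by
  obtain ⟨M, a, hMa, Φ, hΦ⟩ := h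
  have hincl : PseudoRiemannianMetric.IsIsometricImmersion
      (𝓑₁.metric.restrict hres (𝓑₁.docOpens hF hP)).toPseudoRiemannianMetric
      𝓑₁.metric.toPseudoRiemannianMetric
      (Subtype.val : 𝓑₁.docOpens hF hP → 𝓑₁.carrier) := by
    refine ⟨contMDiff_subtype_val, fun x ↦ ?_⟩
    ext v w
    rw [pullbackBilin_apply, Literature.Geometry.Manifold.OpenSubmanifold.mfderiv_subtype_val]
    rfl
  have hsymm : PseudoRiemannianMetric.IsIsometricImmersion
      (Kerr.smoothMetric M a (Kerr.rPlus M a)).toPseudoRiemannianMetric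
      (𝓑₁.metric.restrict hres (𝓑₁.docOpens hF hP)).toPseudoRiemannianMetric Φ.symm := by
    refine ⟨Φ.symm.contMDiff, fun y ↦ ?_⟩
    have hcomp := pullbackBilin_comp (Φ.contMDiff.mdifferentiable (by simp))
      (Φ.symm.contMDiff.mdifferentiable (by simp))
      (Kerr.smoothMetric M a (Kerr.rPlus M a)).toPseudoRiemannianMetric.val
    have hid : ((Φ : 𝓑₁.docOpens hF hP → Kerr.exterior M a) ∘ Φ.symm) = id :=
      funext fun x ↦ Φ.apply_symm_apply x
    have hΦ' := funext hΦ
    rw [hid, pullbackBilin_id] at hcomp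
    -- `hcomp : g_Kerr = Φ.symm^* (Φ^* g_Kerr)`; the inner pull-back is `g|doc` by `hΦ'` (the two
    -- copies differ only in the syntactic carrier `Kerr.exterior` vs `Kerr.region _ _`, defeq).
    have h1 : pullbackBilin (⇑Φ.symm)
        (𝓑₁.metric.restrict hres (𝓑₁.docOpens hF hP)).toPseudoRiemannianMetric.val =
        (Kerr.smoothMetric M a (Kerr.rPlus M a)).toPseudoRiemannianMetric.val := by
      rw [← hΦ']
      exact hcomp.symm
    exact congrFun h1 y
  have hsurj : Function.Surjective (Φ.symm : Kerr.exterior M a → 𝓑₁.docOpens hF hP) :=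
    fun x ↦ ⟨Φ x, Φ.symm_apply_apply x⟩
  refine ⟨M, a, hMa, Subtype.val ∘ Φ.symm, Subtype.val_injective.comp Φ.symm.injective, ?_,
    hincl.comp hsymm⟩
  rw [Set.range_comp, hsurj.range_eq, Set.image_univ]
  ext y
  simp only [Set.mem_range, Subtype.exists, exists_prop, exists_eq_right]
  rfl

section BranchTests

variable [𝓑.metric.HasLeviCivita]

/-- **(T1)** In the NON-ROTATING branch the stationary field `T` is NULL ON THE WHOLE HORIZON:
`g(cT, cT) = 0` there by the Killing identity at a horizon Killing field (`horizonKilling_isNull`),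
and `c ≠ 0`.  So the branch of the dichotomy is decided by ONE horizon point: `g(T,T)(p) ≠ 0` for
some `p ∈ 𝓔⁺` (Kerr with `a ≠ 0`: `g(T,T) = a² sin²θ / Σ > 0` off the poles of `{r = r₊}`) puts the
presentation in the rotating branch (`not_isNonRotating_of_exists_val_ne_zero`).  In particular the
predicate cannot be spoofed by carving the horizon: an open neighbourhood of a pole of the Kerr
horizon contains off-axis horizon points. -/
theorem val_killing_self_eq_zero_of_isNonRotating (h : IsNonRotating 𝓑) {p : 𝓑.carrier}
    (hp : p ∈ 𝓑.horizon) : 𝓑.metric.val p (𝓑.killing p) (𝓑.killing p) = 0 := by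
  obtain ⟨c, hc, hK, -, -, κ, hκ, hgeod⟩ := (h : ∃ c : ℝ, _)
  have h0 := horizonKilling_isNull 𝓑 hK hκ (hgeod p hp)
  have h1 : 𝓑.metric.val p ((c • 𝓑.killing) p) ((c • 𝓑.killing) p) =
      c * c * 𝓑.metric.val p (𝓑.killing p) (𝓑.killing p) := by
    simp only [Pi.smul_apply, map_smul, FunLike.coe_smul, smul_eq_mul]; ring
  rw [h1] at h0
  rcases mul_eq_zero.mp h0 with h2 | h2
  · exact absurd (mul_self_eq_zero.mp h2) hc
  · exact h2

/-- **(T1′)** The one-point test: a horizon point where `T` is not null excludes the non-rotating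
branch. -/
theorem not_isNonRotating_of_exists_val_ne_zero
    (h : ∃ p ∈ 𝓑.horizon, 𝓑.metric.val p (𝓑.killing p) (𝓑.killing p) ≠ 0) :
    ¬ IsNonRotating 𝓑 := fun hnr ↦ by
  obtain ⟨p, hp, hne⟩ := h
  exact hne (val_killing_self_eq_zero_of_isNonRotating 𝓑 hnr hp)

/-- **(T2)** The dichotomy EXHAUSTS h3 (given a non-empty horizon, which h2 supplies): either some
non-zero multiple of `T` is an h3-witness or an h3-witness independent of `T` exists (classical
case split on `K ∈ ℝT`; the same eight lines as the skeleton's composition). -/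
theorem isNonRotating_or_hasIndependentHorizonKilling (h3 : H3 𝓑) (h2 : 𝓑.horizon.Nonempty) :
    IsNonRotating 𝓑 ∨ HasIndependentHorizonKilling 𝓑 := by
  classical
  obtain ⟨K, hK, hne, htan, hκ⟩ := h3
  by_cases hrot : ∃ c : ℝ, K = c • 𝓑.killing
  · obtain ⟨c, rfl⟩ := hrot
    have hc : c ≠ 0 := by
      rintro rfl
      obtain ⟨p, hp⟩ := h2
      exact hne p hp (by simp)
    exact Or.inl fun {_} ↦ ⟨c, hc, hK, hne, htan, hκ⟩
  · exact Or.inr fun {_} ↦ ⟨K, hK, hne, htan, hκ, hrot⟩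

end BranchTests

/-- Stub S1 of the lead's RESHAPED skeleton (≥ 02:50Z), VERBATIM: the re-presentation now also
DELIVERS a complete, `T'`-commuting h3-witness `K'` (absorbing F7(ii): neither completeness nor
commutation is derivable for an arbitrary `I⁺`-regular presentation, so they are produced by the
re-presentation, not assumed of the input). -/
def Stub1RegularRepresentation : Prop :=
  ∀ (𝓑 : StationaryAFBlackHole.{0}) [𝓑.metric.HasLeviCivita],
    𝓑.metric.toPseudoRiemannianMetric.IsRicciFlat → IsConnected 𝓑.horizon →
    𝓑.toSpacetime.IsNonDegenerateHorizon 𝓑.Mext →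
    𝓑.metric.IsGloballyHyperbolic 𝓑.timeOrientation →
      ∃ (𝓑' : StationaryAFBlackHole.{0}) (_ : 𝓑'.metric.HasLeviCivita),
        𝓑'.metric.toPseudoRiemannianMetric.IsRicciFlat ∧ 𝓑'.IsIPlusRegular ∧
        IsConnected 𝓑'.horizon ∧
        (∃ K' : Π x : 𝓑'.carrier, TangentSpace (𝓡 4) x,
          𝓑'.metric.IsKillingField K' ∧ IsCompleteVectorField K' ∧
          (∀ x, VectorField.mlieBracket (𝓡 4) 𝓑'.killing K' x = 0) ∧
          (∀ p ∈ 𝓑'.horizon, K' p ≠ 0) ∧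
          (∀ γ : ℝ → 𝓑'.carrier, IsMIntegralCurve γ K' → γ 0 ∈ 𝓑'.horizon →
            ∀ t, γ t ∈ 𝓑'.horizon) ∧
          ∃ κ : ℝ, κ ≠ 0 ∧ ∀ p ∈ 𝓑'.horizon, 𝓑'.metric.leviCivita K' p (K' p) = κ • K' p) ∧
        ∃ Θ : 𝓑'.docOpens LorentzianMetric.isOpen_chronologicalFuture_holds_of_boundaryless
            LorentzianMetric.isOpen_chronologicalPast_holds_of_boundaryless → 𝓑.carrier,
          Function.Injective Θ ∧ Set.range Θ = 𝓑.doc ∧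
          PseudoRiemannianMetric.IsIsometricImmersion
            (𝓑'.metric.restrict PseudoRiemannianMetric.contMDiff_restrict_holds
              (𝓑'.docOpens LorentzianMetric.isOpen_chronologicalFuture_holds_of_boundaryless
                LorentzianMetric.isOpen_chronologicalPast_holds_of_boundaryless)).toPseudoRiemannianMetric
            𝓑.metric.toPseudoRiemannianMetric Θ

/-- Stub S2 of the reshaped skeleton (its inlined predicate is this file's `IsNonRotating`
verbatim). -/
def Stub2NonRotatingUniqueness : Prop :=
  AlexakisIonescuKlainermanRigidity.{0}
    (fun 𝓑 ↦ 𝓑.IsIPlusRegularNonDegenerate ∧ IsNonRotating 𝓑)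

/-- Stub S3 of the reshaped skeleton, VERBATIM: `I⁺`-regular, connected horizon, a COMPLETE,
`T`-commuting, global second Killing field null-generating `𝓔⁺` with `κ ≠ 0`, not in `ℝT`. -/
def Stub3RotatingUniqueness : Prop :=
  AlexakisIonescuKlainermanRigidity.{0} fun 𝓑 ↦ 𝓑.IsIPlusRegular ∧ IsConnected 𝓑.horizon ∧
    ∀ [𝓑.metric.HasLeviCivita], ∃ K : Π x : 𝓑.carrier, TangentSpace (𝓡 4) x,
      𝓑.metric.IsKillingField K ∧ IsCompleteVectorField K ∧
      (∀ x, VectorField.mlieBracket (𝓡 4) 𝓑.killing K x = 0) ∧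
      (∀ p ∈ 𝓑.horizon, K p ≠ 0) ∧
      (∀ γ : ℝ → 𝓑.carrier, IsMIntegralCurve γ K → γ 0 ∈ 𝓑.horizon → ∀ t, γ t ∈ 𝓑.horizon) ∧
      (∃ κ : ℝ, κ ≠ 0 ∧ ∀ p ∈ 𝓑.horizon, 𝓑.metric.leviCivita K p (K p) = κ • K p) ∧
      ¬ ∃ c : ℝ, K = c • 𝓑.killing

/-- **(T6) After (T4)–(T5) the PICKED line hinges on EXACTLY stubs S1–S3**: the crux BY NAME
from `Stub1RegularRepresentation`, `Stub2NonRotatingUniqueness`, `Stub3RotatingUniqueness` (the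
reshaped skeleton's S1–S3 verbatim; S4–S5 replaced by the theorems `kerrChartTransfer`,
`docIsometryTransfer_gen`; the case split `K' ∈ ℝT'` as in the skeleton's `kerrConclusion_of_regular`).
Kernel-checked, `sorry`-free; it credits nothing (S1–S3 are open) but it is the honest size of the
line: one open problem (S1 = the crux + Hawking-rigid completeness) and two classical un-vendored
theorems (S2: SW93/CW94 + CCH12 Thm 3.1; S3: Beig–Chruściel + CCH12 Thm 3.2). -/
theorem zeroEnergyRigidity_of_stubs123 (s1 : Stub1RegularRepresentation)
    (s2 : Stub2NonRotatingUniqueness) (s3 : Stub3RotatingUniqueness) : ZeroEnergyRigidity := by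
  classical
  intro 𝓑₀ _ _ h1 h2 h3 h4 _ _
  obtain ⟨𝓑', inst', h1', hreg', hconn', ⟨K', hK', hKc', hcomm', hne', htan', hκ'⟩, hΘ⟩ :=
    s1 𝓑₀ h1 h2 h3 h4
  haveI := inst'
  refine docIsometryTransfer_gen 𝓑₀ 𝓑' _ _ _ hΘ ?_
  by_cases hrot : ∃ c : ℝ, K' = c • 𝓑'.killing
  · obtain ⟨c, rfl⟩ := hrot
    have hc : c ≠ 0 := by
      rintro rfl
      obtain ⟨p, hp⟩ := hconn'.nonempty
      exact hne' p hp (by simp)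
    exact kerrChartTransfer 𝓑' (hF_holds 𝓑') (hP_holds 𝓑') (hres_holds 𝓑')
      (s2 𝓑' (hF_holds 𝓑') (hP_holds 𝓑') (hres_holds 𝓑')
        ⟨⟨hreg', hconn', fun {_} ↦ ⟨c • 𝓑'.killing, hK', hne', htan', hκ'⟩⟩,
          fun {_} ↦ ⟨c, hc, hK', hne', htan', hκ'⟩⟩ h1')
  · exact kerrChartTransfer 𝓑' (hF_holds 𝓑') (hP_holds 𝓑') (hres_holds 𝓑')
      (s3 𝓑' (hF_holds 𝓑') (hP_holds 𝓑') (hres_holds 𝓑')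
        ⟨hreg', hconn', fun {_} ↦ ⟨K', hK', hKc', hcomm', hne', htan', hκ', hrot⟩⟩ h1')

/-- **(F12) Verdicts on the five registered stubs** (no stub broken; one proof-plan trap).

1. `stub_regularRepresentation` (h1–h4 ⇒ ∃ `I⁺`-regular non-degenerate vacuum `𝓑'` with
   `DocIsometry 𝓑' 𝓑`; RESHAPED S1 additionally outputs a complete, `T'`-commuting witness `K'`) — NOT
   ATTACKABLE BELOW THE CRUX: in the planner's form it is trivially true at `I⁺`-regular presentations
   by (T3); in the lead's reshaped form even an `I⁺`-regular input must be re-presented (carved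
   `I⁺`-regular presentations have no complete `K`, F7(ii)) — to the full chart; either way, modulo
   S2–S5 plus the (true, un-vendored) regularity facts of the in-tree Kerr presentation
   (`Kerr.stationaryAFBlackHoleOn M a r₀`: `I⁺`-regular, `K' = ∂_{t*} + Ω_H ∂_φ` complete on `{r > r₀}`
   and commuting with `∂_{t*}`) it is EQUIVALENT to `CoreRigidityGH` (crux ⇒ doc ≅ Kerr exterior ⇒
   `𝓑' :=` Kerr).  Every junk presentation of (F4)/(F7) has such a `𝓑'`.  A kill of S1 is a kill of
   the crux; none is known (F1).  For the lead: S1 is where ALL the open-problem content sits; S2–S3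
   are classical, S4–S5 are closed here.
2. `stub_nonRotatingUniqueness` (AIK schema at `I⁺`-regular ∧ `IsNonRotating`) — survives; printed
   chain CCH12 §3.3.1 (Sudarsky–Wald staticity via the Chruściel–Wald maximal slice, then
   Chruściel–Galloway 2010 / CCH12 Thm 3.1), all stated for `I⁺`-regular holes.  Typing checked:
   `IsNonRotating` cannot be spoofed (T1: it forces `g(T,T) = 0` on all of `𝓔⁺`; carving cannot shrink
   `𝓔⁺` to the poles since `𝓔⁺ ∩ U` is relatively open); it is invariant under `T ↦ cT` (F10) and
   under `K ↦ cK` (F9) by its own `∃ c`.  The schema quantifies over presentations whose CARRIER may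
   be acausal beyond `doc ∪ 𝓔⁺` (only `IsGloballyHyperbolicSet doc` is asked): harmless, the
   conclusion `IsIsometricToKerrExterior` sees `docOpens` only, and interior junk cannot change
   `doc`/`𝓔⁺` (causal convexity).
3. `stub_rotatingUniqueness` (AIK schema at `I⁺`-regular ∧ `HasIndependentHorizonKilling`) — survives
   as a STATEMENT; PROOF-PLAN TRAP (F7(ii) made specific) — **RESOLVED by the lead's reshape of
   02:50Z+, which moved completeness of `K'` and `[T',K'] = 0` into S1's OUTPUT and S3's HYPOTHESIS
   (`Stub1RegularRepresentation`, `Stub3RotatingUniqueness` below are the reshaped statements); the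
   analysis that forced it:** the vendored endgame
   `ChruscielCostaHeusler2012_axisymmetricUniqueness` needs `IsStationaryAxisymmetric 𝓑` — an axial
   Killing field `Y` COMPLETE ON THE WHOLE CARRIER with all orbits `2π`-periodic — which is FALSE for
   `I⁺`-regular interior-carved presentations (`U = M ∖ cl J⁺(T·B̄)`, `B` a closed ball inside the hole
   off the axis: `I⁺`-regular, vacuum, `K = T + Ω_H Φ` global, doc = Kerr exterior, but `Φ`-orbits
   through points next to the carved set leave `U`).  So the stub cannot be closed by
   "Beig–Chruściel ⇒ `IsStationaryAxisymmetric 𝓑` ⇒ vendored fact" verbatim; it needs either a second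
   re-presentation (a `T,Y`-invariant sub-carrier ⊇ `doc ∪ 𝓔⁺` on which `Y` is complete — note that
   restricting to `doc` alone EMPTIES the horizon, `𝓔⁺_doc = ∅`, and kills `IsIPlusRegularNonDegenerate`)
   or a doc-level version of CCH12 Thm 3.2 (axisymmetry of `⟨⟨M_ext⟩⟩ ∪ 𝓔⁺` only; Chruściel 1993
   completeness of Killing orbits in a GH d.o.c.).  Recommend vendoring the latter.
4. `stub_kerrChartTransfer` (`IsIsometricToKerrExterior hF hP hres → KerrConclusion`) — PROVED here
   as typed, (T5) `kerrChartTransfer`, no trap: `Ψ := Subtype.val ∘ Φ.symm`; injective (`Φ.symm.injective`, `Subtype.val_injective`); range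
   `= doc` (`Φ.symm` surjective, `Subtype.range_coe`); isometric immersion: `Φ.symm` is an isometry of
   the restricted metric (from `IsIsometry … Φ` by `pullbackBilin_comp` + `pullbackBilin_id` applied to
   `Φ.symm ∘ Φ = id`), composed (`IsIsometricImmersion.comp`, `CauchyProblemCauchy.lean`) with the
   inclusion, which is an isometric immersion of the restricted metric by (T3)'s computation
   (`OpenSubmanifold.mfderiv_subtype_val`).
5. `stub_docIsometryTransfer` (`DocIsometry 𝓑' 𝓑 → KerrConclusion 𝓑' → KerrConclusion 𝓑`) — PROVED
   here as typed, (T4) `docIsometryTransfer`, no trap (one wrinkle for the transplant: `Kerr.exterior M a`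
   unfolds to `Kerr.region a (Kerr.rPlus M a)` and `rw` is sensitive to which spelling a term
   carries — type the corestriction over `Kerr.region _ _`): corestrict `Ψ' : Kerr.exterior → 𝓑'` to `docOpens' 𝓑'` (`range Ψ' = doc'`; smoothness
   by `ContMDiff.subtypeVal_comp_iff`, Mathlib; differential unchanged: `mfderiv_comp` +
   `OpenSubmanifold.mfderiv_subtype_val`), then `IsIsometricImmersion.comp` with `Θ`; range
   `= Θ '' univ = doc`.  Universe/model check: `Kerr.exterior M a` is modelled on `𝓘(ℝ, E4)`, the
   carriers on `𝓡 4`; `IsIsometricImmersion.comp` is model-polymorphic — fine.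
All five are insensitive to (F8) (no h5), (F9) (`κ ≠ 0` only), (F10) (no normalisation of `T`), and
to (b′) (conclusion verbatim, no `∃!`, no sign of `a`).  With (T4)–(T6) the honest size of the line is:
stub 1 (= the crux, open problem) + stubs 2–3 (classical, un-vendored; stub 3 with the proof-plan
trap above). -/
theorem targets_pretriage : True := trivial

end Targets

/-! ## (F13–F15, cycle 3) New attacks this cycle — all dead, recorded so nobody repeats them -/

/-- **(F13) The antipodal quotient admits NO asymptotically flat slice at all** (strengthens junk
(13), which only treated the `t* = const` slice).  `P : (t*, x⃗) ↦ (t*, −x⃗)` is a free isometry of the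
Kerr black-hole chart commuting with `T, Φ` (`r`, `H` are even, `ℓ`'s spatial part is odd), and
`Kerr/P` is smooth, Ricci-flat, stationary, globally hyperbolic (`t*` descends), with connected
non-degenerate horizon `ℝ × ℝP²` and `doc ≅ ℝ × (r₊,∞) × ℝP²` (π₁ = ℤ₂: NOT a Kerr exterior).  It
satisfies h1–h6 and falsifies the conclusion — IF it were a `StationaryAFBlackHole`.  It is not, for
ANY choice of slice: an `AFEnd` of a slice `X ↪ Kerr/P` is simply connected (`≅ {‖y‖ > R}`), so it
lifts to the double cover; there the AF decay (`h − δ = O₂(r^{−α})`, `k = O₁(r^{−α−1})`, closed at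
infinity) makes the unit normal converge (`Σ_k (2^k R)^{−α} < ∞`) and the chart asymptotically
affine, so the far region is a spacelike GRAPH `t* = G(x⃗)` over a neighbourhood of infinity of
`ℝ³` (injectivity of the projection from `dΦ → A_∞`); its `P`-image is the graph of `G ∘ (−id)`; the
two lifts of the end are disjoint iff `G(x⃗) ≠ G(−x⃗)` for all large `x⃗` — impossible, `G − G∘(−id)`
is odd and continuous on the connected set `{‖x⃗‖ > ρ}`.  A common zero is a fixed point of the free
involution `P`: contradiction.  So (13) is killed by the STRUCTURE (one `S²`-end), robustly.

**(F14) Orientation / `κ < 0` hunt (F11 follow-up), dead ends.**  (i) Full Kruskal (two-ended,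
GH, `T = ∂_t` future-directed on the chosen end): h1–h5 hold, `𝓔⁺ = {U = 0, V > 0}`, `κ > 0`,
doc = Schwarzschild exterior — conclusion TRUE (`a = 0`); the second end is invisible to the
structure (one chosen `AFEnd`; the slice may even be a half-bridge).  (ii) The pattern "future-directed
generator Killing field SPACELIKE on the doc side" (`κ < 0`) is realised in Kerr exactly at the INNER
horizon `r = r₋` seen from region II — so a `κ < 0` future event horizon needs an AF end whose doc
contains a region-II-like block, i.e. Kerr presented from the `r → −∞` end (AF, `T` timelike there,
negative mass): dead — region III (`r < r₋`) is totally vicious (Carter), ¬h4; carving the time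
machine leaves a `T`-invariant timelike boundary (diamonds leak), ¬h4.  (iii) ℝP³ geon (Kruskal/`J`,
`J(T,X,ω) = (T,−X,−ω)`): `∂_t` is `J`-odd — not stationary.  (iv) `(t* ↦ t* + L) ∘ P` quotient: its
square is a time translation — closed `T`-orbits, CTCs, ¬h4.  The orientation lemma ("h1–h4 ⇒ the
future-directed normalisation of h3's `K` has `κ > 0`") stays OPEN: equivalent, for `K` complete along
`𝓔⁺`, to future affine completeness of the generators of `𝓔⁺` (`λ = e^{κv}/κ`); no GH vacuum
presentation with future-incomplete event-horizon generators is known, none is excluded here.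

**(F15) Exact-solution sweep for a non-Kerr inhabitant of h1–h4** (all dead, reason in brackets):
Weyl-distorted Schwarzschild / Geroch–Hartle [vacuum distortion potential singular or non-decaying:
¬smooth or ¬AF]; Israel–Khan, double-Kerr(–NUT) [h2 disconnected; strut ⇒ ¬h4; strut-free balance
needs hyperextreme/negative-mass constituents (Neugebauer–Hennig)]; Zipoy–Voorhees, Tomimatsu–Sato
δ = 2, Manko–Novikov [naked (ring) singularities / CTC regions in the would-be doc: ¬h4; TS2 horizon
degenerate]; Curzon–Schwarzschild [directional naked singularity: ¬h4]; C-metric, Ernst [boost `T` not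
timelike on a whole slice end]; Kerr–NUT, Taub–NUT [Misner string or periodic `t`: ¬h4 / no spacelike
AF slice]; `T ↦ T + ΩΦ` re-presentations [not timelike far out; only `c • T` survives, F10]; negative-mass
Schwarzschild/Kerr [no horizon: ¬h2].  Literature refresh (`lit search`, 2023–2026) for smooth
non-analytic rigidity / counterexamples: see NOTES.md of the seat (searchd was unavailable at the
first attempt; results appended there and in the next revision of this docstring).  `lit galaxy
search --star all` ("uniqueness of smooth stationary black holes", "black hole uniqueness without
analyticity", intelligent mode on non-analytic rigidity / non-Kerr smooth stationary vacuum holes;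
03:30Z): no counterexample literature; nearest hits Mars gr-qc/0004018 (local Mars–Simon
characterisation, the input of AIK), Hollands–Yazadjiev 0812.3036 (KK uniqueness under extra
symmetry), Figueras–Wiseman 1610.06178 (stationary Ricci solitons) — none bears on `CoreRigidityGH`.

**(F16) Typing remark: `M_ext` is not "near infinity".**  `M_ext = ⋃ₜ φₜ(embed (e.far (e.R + 1)))`
and the AF decay constants of `e` are unconstrained, so a presentation may take the coordinate
sphere `‖y‖ = R + 1` to be a horizon cross-section of the slice (Schwarzschild, ingoing slice
`t* = 0`, chart on `{r > 2M − ε} ∩ Σ`): then `M_ext` is the WHOLE exterior `{r > 2M}`, `cl M_ext ⊇ 𝓔⁺`,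
and Hawking–Ellis Prop. 6.3.1 (generators of `∂I⁻(S) ∖ cl S`) says nothing about the generators of
`𝓔⁺` in that presentation.  In general `M_ext` can be any `T`-invariant open part of
`{T timelike} ∩ doc` containing a slice end; stubs must not assume `dist(M_ext, 𝓔⁺) > 0`, a collar
disjoint from `M_ext`, or "`M_ext` outside a large sphere" — only `M_ext ⊆ {g(T,T) < 0} ∩ doc`. -/
theorem cycle3_survey : True := trivial

/-- **(F17)–(F18), cycle 4 — see the module docblock.**  Paper checks recorded here so nobody
repeats them: (1) the Minkowski witness `minkowskiBH` (empty horizon) breaks NO registered stub: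
S1 `stub_regularRepresentation`, S2 (via `IsIPlusRegularNonDegenerate`), S3 (explicit
`IsConnected 𝓑.horizon`) of the picked line, every stub of `osculating-frontier-induction` (through
`IsKillingTimelikeCollar ⊇ IsConnected 𝓑.horizon` in `RegularTelescope`) exclude it, and the two
proper stubs of `zero-frequency-pohozaev-pair` HOLD at it (G1: with `T = ∂ₜ` no non-zero null vector is
`T`-orthogonal, so the non-trapping clause is vacuous and the escape pair `b = −∂_{x¹}`, `f = x¹`,
`α = 1` works for every compact `S`: `∇b = 0`, `df(b) = −1`, `−α η(v,v) < 0` on spatial `v ≠ 0`; G2: a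
`∂ₜ`-commuting field Killing on the connected flat region `ℝ × (ℝ³ ∖ S₀)` is affine there and extends
to a global Killing field).  (2) No in-tree witness for the remaining near-misses: without-h4 needs a
quotient manifold (`Kerr/ℤ_L`), without-h1 needs Kerr–Newman + naturality of `Ric` under local
isometries, without-h3 has no paper witness (every horizon-penetrating extremal Kerr–Schild chart is
non-GH; flat `T`-invariant proper sub-carriers `ℝ × V`, `V ⊊ ℝ³`, are never GH; sub-`r₋` Kerr charts
keep `doc = {r > r₊}` and a TRUE conclusion).  (3) The inextendibility route to "doc is not a Kerr
exterior" works ONLY for horizonless junk (a genuine d.o.c. is always extendible across `𝓔⁺`), so it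
offers no attack on the crux itself. -/
theorem cycle4_survey : True := trivial

/-! ## (e) Near-misses — `sorry` permitted ONLY here; each docstring = witness + obstruction -/

/-- Crux without h4 (global hyperbolicity). -/
def FullRigidityWithoutH4 : Prop :=
  ∀ (𝓑 : StationaryAFBlackHole.{0}) [𝓑.metric.HasLeviCivita] [Kerr.Facts],
    H1 𝓑 → H2 𝓑 → H3 𝓑 → H5 𝓑 → NoImprisonedRay 𝓑 → KerrConclusion 𝓑

/-- Crux without h2 (connected, non-empty horizon). -/
def FullRigidityWithoutH2 : Prop :=
  ∀ (𝓑 : StationaryAFBlackHole.{0}) [𝓑.metric.HasLeviCivita] [Kerr.Facts],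
    H1 𝓑 → H3 𝓑 → H4 𝓑 → H5 𝓑 → NoImprisonedRay 𝓑 → KerrConclusion 𝓑

/-- Crux without h1 (vacuum). -/
def FullRigidityWithoutH1 : Prop :=
  ∀ (𝓑 : StationaryAFBlackHole.{0}) [𝓑.metric.HasLeviCivita] [Kerr.Facts],
    H2 𝓑 → H3 𝓑 → H4 𝓑 → H5 𝓑 → NoImprisonedRay 𝓑 → KerrConclusion 𝓑

/-- NEAR-MISS (any proof must use h4).  Witness: the quotient Kerr/ℤ_L of the black-hole chart
`Kerr.region a r₀` (`|a| < M`, `r₋ < r₀ < r₊`) by `t* ↦ t* + L`: smooth, Ricci-flat, `∂_{t*}` complete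
Killing and timelike on the (injectively embedded) far end, horizon `{r = r₊}/ℤ ≅ S¹ × S²` connected and
non-degenerate (`K = ∂_{t*} + Ω_H ∂_φ` descends), `T ≠ 0`, h6 true WITHOUT h4 (trivially: no
zero-energy null geodesic of the chart meeting the d.o.c. is a geodesic on all of `[0,∞)` — future
ones plunge, `R(r) = a²L² − Δ(L²+Q)` decreasing on `r > M`, and leave the chart through `{r = r₀}` at
finite affine parameter, past ones leave through the past-horizon edge; the future-complete horizon
generators are zero-energy null rays but never meet `doc ⊇ K`), yet `doc = {r > r₊}/ℤ` has `π₁ = ℤ`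
so no bijective immersion from the simply connected `Kerr.exterior M' a'` exists.
OBSTRUCTION: no quotient-manifold (`ChartedSpace` on `E4/ℤ`-type quotients) construction in tree, and
the causal identifications of the Kerr chart are un-vendored.  [junk_survey (8)] -/
theorem fullRigidity_false_without_H4 : ¬ FullRigidityWithoutH4 := by
  sorry

/-- **PROVED in cycle 4 (F17)** — the `sorry` below is only a placeholder: the proof is the LANDED
theorem `Summit.FinalStateConjecture.FinalStateConjecture.Theorems.ZeroEnergyRigidity.Negative.
zeroEnergyRigidity_false_without_H2` (`Negative/MinkowskiNoHorizon.lean`, p82698, commit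
6f07fceca40e), whose statement is this one with `H1 … KerrConclusion` unfolded (definitionally); the
kernel link (`import …Negative.MinkowskiNoHorizon` + `:= Negative.zeroEnergyRigidity_false_without_H2`,
file `Disproof7.lean` in the seat folder, checked as soon as the farm has built the new module) is
the next revision of this file.  Witness: Minkowski `ℝ⁴` as a
`StationaryAFBlackHole` (`minkowskiBH`: `T = ∂ₜ`, slice `{t = 0}`, trivial data, end `{‖y‖ > 1}`):
h1 (`Minkowski.isRicciFlat_holds`); h3 vacuously (`𝓔⁺ = ∅`, `horizon_minkowskiBH`); h4
(`Minkowski.isGloballyHyperbolic`); h5; h6 vacuously (a null `v` with `η(∂ₜ, v) = 0` is `0`);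
conclusion FALSE by Sbierski's `C⁰`-inextendibility of Minkowski space (tree theorem
`minkowski_isC0Inextendible_holds`): a bijective isometric immersion of a Kerr exterior onto `ℝ⁴`
is a diffeomorphism (IFT) and `{r > r₊} ⊊ {r > 0}` would extend Minkowski space.  The cycle-1
obstructions (GH of Minkowski, `I^±(M_ext) = ℝ⁴`, distinguishing `ℝ⁴` from a Kerr exterior) are all
resolved: the first is in the tree since `MinkowskiGlobalHyperbolicity.lean`, the second is four
straight timelike segments, the third needs neither topology nor curvature — inextendibility.
[junk_survey (1)] -/
theorem fullRigidity_false_without_H2 : ¬ FullRigidityWithoutH2 := by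
  sorry

/-- NEAR-MISS (any proof must use h1).  Witness: sub-extremal Kerr–Newman (`M² > a² + Q²`, `Q ≠ 0`)
in ingoing Kerr–Schild form `g = η + 2Hℓ⊗ℓ`, `H = (2Mr − Q²) r² / (2(r⁴ + a²z²))`, chart `{r > r₀}`,
`r₋ < r₀ < r₊`: h2–h6 exactly as for Kerr, not Ricci-flat, and its d.o.c. is not locally isometric to
any Kerr exterior (`Ric ≠ 0`).  OBSTRUCTION: no Kerr–Newman `StationaryAFBlackHole` in tree; isometry
invariance of `ricci` under `IsIsometricImmersion` (naturality of `leviCivita`) is un-vendored.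
[junk_survey (9)] -/
theorem fullRigidity_false_without_H1 : ¬ FullRigidityWithoutH1 := by
  sorry

end Summit.FinalStateConjecture.FinalStateConjecture.Cruxes.ZeroEnergyRigidity.Disproof

end
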